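import Literature.Topology.FourManifolds.CappellShanesonClassGroupFifteen
import Literature.Topology.FourManifolds.CappellShanesonIdealCertificates
import HarnessLib

/-!
# The class group of the trace `24` field (discriminant `210649 = 313 · 673`) and Gompf's conjecture
# for the traces `24` and `-19` (Kim–Yamada 2023, Theorem B)

Serves the named fact
`Literature.Topology.FourManifolds.kimYamada2023_nonempty_diffeomorph_sphere_four_of_trace_mem_Icc`
(`CappellShaneson.lean`; M. H. Kim, S. Yamada, Kyungpook Math. J. 63 (2023) 373–411 =
arXiv:1707.03860, Cor. C), reduced in the tree to Gompf's topological leaves and Theorem B in matrix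
form (`GompfConjectureForTrace n`) for the traces not yet proved. This file PROVES Theorem B for the
trace `24` — the first trace whose class group is NOT cyclic (a quotient of `ℤ/2 × ℤ/2`): `C(ℤ[Θ₂₄])` is
covered by the representatives `(1, 1, 24)`, `(6, 7, 24)`, `(3, 11, 24)`, `(17, 23, 24)`, which move by
Gompf moves to the traces `24`, `10`, `2`, `1` (Lemma 6.1 / §6.1), where Gompf's conjecture holds —
and, by Theorem A, for `-19 = 5 - 24`.

## The number theory

For a cubic number field `K` generated by a root `θ` of `f₂₄ = x³ - 24x² + 23x - 1`:

* `Δ(f₂₄) = 210649 = 313 · 673` is squarefree, so `𝓞 K = ℤ[θ]`, `d_K = 210649`, `⌊M_K⌋ ≤ 129`;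
* Dedekind–Kummer at `p ≤ 129` (Marcus, Ch. 3, Thm. 27): `2, 3, 5, 13, 17, 31, 47, 59, 61, 83, 97, 101` are
  inert; `7` and `11` are a linear times an irreducible quadratic factor; `29, 41, 43, 67, 103, 109`
  split; unique roots `5, 17, 19, 47, 17, 6, 32, 47, 72, 32, 115` modulo
  `19, 23, 37, 53, 71, 73, 79, 89, 107, 113, 127`;
* `a = [𝔭₇]`, `c = [𝔭₁₁]` satisfy `a² = c² = 1` (`𝔭₇² = (θ + 1)`, `𝔭₁₁² = (θ - 3)`), `[𝔭₂₃] = a c`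
  (`𝔭₇ 𝔭₁₁ = (77, θ - 69)`, `(77, θ - 69) 𝔭₂₃ = (2θ² - 3θ + 2)`), and every other small prime lies in
  `{1, a, c, ac}` by an explicit relation with certified cofactors: `𝔭₇ 𝔮₄₉ = (7)`, `𝔭₁₁ 𝔮₁₂₁ = (11)`,
  `𝔭₁₁ 𝔭₁₉ = (4θ - 1)`, `𝔭₇ (29, θ - 8) = (4θ - 3)`, `𝔭₂₃ (29, θ - 21) = (3θ - 5)`, `𝔭₁₁ (29, θ - 24) =
  (5θ - 4)`, `𝔭₃₇ = (2θ - 1)`, `𝔭₇ (41, θ - 15) = (3θ - 4)`, `𝔭₂₃ (41, θ - 16) = (θ² + 2θ - 1)`,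
  `𝔭₁₁ (41, θ - 34) = (θ² + θ - 1)`, `(43, θ - 2) = (θ - 2)`, `(41, θ - 16)(43, θ - 31) = (3θ - 7)`,
  `𝔭₂₃ (43, θ - 34) = (θ² - 5θ + 3)`, `𝔭₂₃ 𝔭₅₃ = (θ + 6)`, `𝔭₁₁ (67, θ - 44) = (3θ + 2)`,
  `𝔭₇ (67, θ - 56) = (6θ - 1)`, `𝔭₂₃ (67, θ - 58) = (7θ - 4)`, `𝔭₂₃ 𝔭₇₁ = (θ - 17)`, `𝔭₇ 𝔭₇₃ = (θ - 6)`,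
  `𝔭₇ 𝔭₇₉ = (5θ - 2)`, `𝔭₇ 𝔭₈₉ = (2θ - 5)`, `𝔭₇ (103, θ - 67) = (θ² - 4θ + 2)`, `𝔭₂₃ (103, θ - 76) =
  (θ² + 15θ - 15)`, `𝔭₁₁ (103, θ - 87) = (6θ - 7)`, `𝔭₁₀₇ = (3θ - 2)`, `𝔭₁₁ (109, θ - 25) = (2θ² - 2θ - 1)`,
  `𝔭₁₁ (109, θ - 35) = (16θ - 15)`, `(109, θ - 73) = (3θ - 1)`, `𝔭₇ 𝔭₁₁₃ = (2θ² - 4θ + 1)`,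
  `𝔭₂₃ 𝔭₁₂₇ = (θ² - 9θ + 2)`;
* hence every ideal class is `1`, `a`, `c` or `ac` (`classGroup_mem_four_twentyfour`).

Transport to `ℤ[X]/(f₂₄)` and Prop. 2.14 (`exists_isConj_standardCSMatrix_of_cover`):
`isConj_standardCSMatrix_of_trace_eq_twentyfour`, `gompfConjectureForTrace_twentyfour`,
`gompfConjectureForTrace_neg_nineteen`. No named fact is introduced (D-0026).

## References

* [KimYamada2023] M. H. Kim, S. Yamada, Kyungpook Math. J. 63 (2023) 373–411 (arXiv:1707.03860):
  §2.3 (Prop. 2.14), §5 (Table 2), §6.1 (Lemma 6.1 and the proof of Thm. B), Thm. A.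
* [Marcus2018] D. A. Marcus, *Number Fields*, 2nd ed., Ch. 3, Thm. 27 (Dedekind–Kummer); Ch. 5,
  Cor. 2 of Thm. 37 (Minkowski bound).
-/

noncomputable section

open Set Polynomial Module NumberField Ideal
open scoped NumberField MatrixGroups nonZeroDivisors
open Literature.LinearAlgebra.Matrix

namespace Literature.Topology.FourManifolds


section Field

variable {K : Type*} [Field K] [NumberField K] {θ : K}

/-! ### Discriminant `210649` and `𝓞 K = ℤ[θ]` -/

/-- `Δ(f₂₄) = 24·22·21·19 - 23 = 210649`. [cite: KimYamada2023, §3 (Δ(fₙ) = n(n-2)(n-3)(n-5) - 23)] -/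
theorem csDisc_twentyfour : csDisc 24 = 210649 := by
  decide

set_option maxRecDepth 8192 in
/-- `210649 = 313 · 673` is squarefree, so `Δ(f₂₄)` has no factorisation `r² e` with `|e| > 2`,
`r ≠ ±1`, and `𝓞 K = ℤ[θ]`. [folklore] -/
theorem csDisc_twentyfour_sq : ∀ r e : ℤ, csDisc 24 = r ^ 2 * e → 2 < |e| → IsUnit r :=
  isUnit_of_eq_sq_mul (B := 458) (by decide) (by decide) (by decide)

/-- `d_K = 210649` for the trace `24` field. [folklore] -/
theorem discr_eq_twentyfour (hθ : aeval θ (csPoly 24) = 0) (h3 : finrank ℚ K = 3) :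
    NumberField.discr K = 210649 := by
  rw [discr_eq_csDisc_of_sq hθ h3 csDisc_twentyfour_sq, csDisc_twentyfour]

/-- The cubic relation `θ³ - 24θ² + 23θ - 1 = 0` in `𝓞 K`. [folklore] -/
theorem thetaInt_rel_twentyfour (hθ : aeval θ (csPoly 24) = 0) :
    (thetaInt hθ) ^ 3 - 24 * (thetaInt hθ) ^ 2 + 23 * thetaInt hθ - 1 = 0 := by
  have rel := thetaInt_rel hθ
  push_cast at rel
  linear_combination rel

/-! ### The primes of norm at most `129` (Dedekind–Kummer) -/

set_option maxRecDepth 16384 in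
/-- The inert primes `2, 3, 5, 13, 17, 31, 47, 59, 61, 83, 97, 101` (no root of `f₂₄`): every prime above them is `(p)`. [folklore] -/
theorem eq_span_of_inert_twentyfour (hθ : aeval θ (csPoly 24) = 0) (h3 : finrank ℚ K = 3) {p : ℕ}
    (hp : p = 2 ∨ p = 3 ∨ p = 5 ∨ p = 13 ∨ p = 17 ∨ p = 31 ∨ p = 47 ∨ p = 59 ∨ p = 61 ∨ p = 83 ∨ p = 97 ∨ p = 101)
    {P : Ideal (𝓞 K)} (hP : P ∈ primesOver (span {(p : ℤ)}) (𝓞 K)) : P = span {(p : 𝓞 K)} := by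
  rcases hp with rfl | rfl | rfl | rfl | rfl | rfl | rfl | rfl | rfl | rfl | rfl | rfl
  · exact eq_span_of_no_root_of_sq hθ h3 csDisc_twentyfour_sq (by norm_num) hP (by decide)
  · exact eq_span_of_no_root_of_sq hθ h3 csDisc_twentyfour_sq (by norm_num) hP (by decide)
  · exact eq_span_of_no_root_of_sq hθ h3 csDisc_twentyfour_sq (by norm_num) hP (by decide)
  · exact eq_span_of_no_root_of_sq hθ h3 csDisc_twentyfour_sq (by norm_num) hP (by decide)
  · exact eq_span_of_no_root_of_sq hθ h3 csDisc_twentyfour_sq (by norm_num) hP (by decide)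
  · exact eq_span_of_no_root_of_sq hθ h3 csDisc_twentyfour_sq (by norm_num) hP (by decide)
  · exact eq_span_of_no_root_of_sq hθ h3 csDisc_twentyfour_sq (by norm_num) hP (by decide)
  · exact eq_span_of_no_root_of_sq hθ h3 csDisc_twentyfour_sq (by norm_num) hP (by decide)
  · exact eq_span_of_no_root_of_sq hθ h3 csDisc_twentyfour_sq (by norm_num) hP (by decide)
  · exact eq_span_of_no_root_of_sq hθ h3 csDisc_twentyfour_sq (by norm_num) hP (by decide)
  · exact eq_span_of_no_root_of_sq hθ h3 csDisc_twentyfour_sq (by norm_num) hP (by decide)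
  · exact eq_span_of_no_root_of_sq hθ h3 csDisc_twentyfour_sq (by norm_num) hP (by decide)

set_option maxRecDepth 16384 in
/-- The degree-one primes at primes with a unique root of `f₂₄`: `(19, θ - 5)`, `(23, θ - 17)`, `(37, θ - 19)`, `(53, θ - 47)`, `(71, θ - 17)`, `(73, θ - 6)`, `(79, θ - 32)`, `(89, θ - 47)`, `(107, θ - 72)`, `(113, θ - 32)`, `(127, θ - 115)` are the only
primes `P` above them with `p ^ {f_P} ≤ 129`. [folklore] -/
theorem eq_span_pair_of_unique_root_twentyfour (hθ : aeval θ (csPoly 24) = 0) (h3 : finrank ℚ K = 3)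
    {p : ℕ} {c₀ : ℤ}
    (hp : (p = 19 ∧ c₀ = 5) ∨ (p = 23 ∧ c₀ = 17) ∨ (p = 37 ∧ c₀ = 19) ∨ (p = 53 ∧ c₀ = 47) ∨ (p = 71 ∧ c₀ = 17) ∨ (p = 73 ∧ c₀ = 6) ∨ (p = 79 ∧ c₀ = 32) ∨ (p = 89 ∧ c₀ = 47) ∨ (p = 107 ∧ c₀ = 72) ∨ (p = 113 ∧ c₀ = 32) ∨ (p = 127 ∧ c₀ = 115))
    {P : Ideal (𝓞 K)} (hP : P ∈ primesOver (span {(p : ℤ)}) (𝓞 K)) (hle : p ^ P.inertiaDeg ℤ ≤ 129) :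
    P = span {(p : 𝓞 K), thetaInt hθ - (c₀ : 𝓞 K)} := by
  rcases hp with ⟨rfl, rfl⟩ | ⟨rfl, rfl⟩ | ⟨rfl, rfl⟩ | ⟨rfl, rfl⟩ | ⟨rfl, rfl⟩ | ⟨rfl, rfl⟩ | ⟨rfl, rfl⟩ | ⟨rfl, rfl⟩ | ⟨rfl, rfl⟩ | ⟨rfl, rfl⟩ | ⟨rfl, rfl⟩
  · exact eq_span_pair_of_unique_root_of_sq hθ h3 csDisc_twentyfour_sq (by norm_num) hP hle
      (by decide) (by norm_num)
  · exact eq_span_pair_of_unique_root_of_sq hθ h3 csDisc_twentyfour_sq (by norm_num) hP hle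
      (by decide) (by norm_num)
  · exact eq_span_pair_of_unique_root_of_sq hθ h3 csDisc_twentyfour_sq (by norm_num) hP hle
      (by decide) (by norm_num)
  · exact eq_span_pair_of_unique_root_of_sq hθ h3 csDisc_twentyfour_sq (by norm_num) hP hle
      (by decide) (by norm_num)
  · exact eq_span_pair_of_unique_root_of_sq hθ h3 csDisc_twentyfour_sq (by norm_num) hP hle
      (by decide) (by norm_num)
  · exact eq_span_pair_of_unique_root_of_sq hθ h3 csDisc_twentyfour_sq (by norm_num) hP hle
      (by decide) (by norm_num)
  · exact eq_span_pair_of_unique_root_of_sq hθ h3 csDisc_twentyfour_sq (by norm_num) hP hle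
      (by decide) (by norm_num)
  · exact eq_span_pair_of_unique_root_of_sq hθ h3 csDisc_twentyfour_sq (by norm_num) hP hle
      (by decide) (by norm_num)
  · exact eq_span_pair_of_unique_root_of_sq hθ h3 csDisc_twentyfour_sq (by norm_num) hP hle
      (by decide) (by norm_num)
  · exact eq_span_pair_of_unique_root_of_sq hθ h3 csDisc_twentyfour_sq (by norm_num) hP hle
      (by decide) (by norm_num)
  · exact eq_span_pair_of_unique_root_of_sq hθ h3 csDisc_twentyfour_sq (by norm_num) hP hle
      (by decide) (by norm_num)

/-- `f₂₄ = (x - 6)(x^2 + 3 * x - 1) + 7(-3 * x^2 + 6 * x - 1)`: the factorisation modulo `7`. [folklore] -/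
theorem csPoly_twentyfour_eq_seven :
    csPoly 24 = (X - 6) * (X ^ 2 + 3 * X - 1) + 7 * (-3 * X ^ 2 + 6 * X - 1) := by
  simp only [csPoly, map_sub, map_one, map_ofNat]
  ring

set_option linter.unusedSimpArgs false in
/-- The lift `X ^ 2 + 3 * X - 1` reduces modulo `7` to the same expression in `𝔽₇[x]`. [folklore] -/
theorem map_quad_twentyfour_seven :
    (X ^ 2 + 3 * X - 1 : ℤ[X]).map (Int.castRingHom (ZMod 7)) = X ^ 2 + 3 * X - 1 := by
  simp only [Polynomial.map_add, Polynomial.map_sub, Polynomial.map_neg, Polynomial.map_mul, Polynomial.map_pow,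
    map_X, Polynomial.map_ofNat, Polynomial.map_one]

set_option linter.unusedSimpArgs false in
/-- `f₂₄ mod 7 = (x - 6)·(X ^ 2 + 3 * X - 1)`. [folklore] -/
theorem csPolyMod_twentyfour_seven :
    csPolyMod 24 7 = (X - C ((6 : ℤ) : ZMod 7)) *
      (X ^ 2 + 3 * X - 1 : ℤ[X]).map (Int.castRingHom (ZMod 7)) := by
  rw [csPolyMod, csPoly_twentyfour_eq_seven, Polynomial.map_add]
  have hp : Polynomial.map (Int.castRingHom (ZMod 7)) (7 * (-3 * X ^ 2 + 6 * X - 1) : ℤ[X]) = 0 := by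
    rw [Polynomial.map_mul, show (7 : ℤ[X]) = C 7 from rfl, Polynomial.map_C]
    have : (Int.castRingHom (ZMod 7)) 7 = 0 := by decide
    rw [this, C_0, zero_mul]
  rw [hp, add_zero, map_quad_twentyfour_seven]
  simp only [Polynomial.map_mul, Polynomial.map_sub, Polynomial.map_add, Polynomial.map_neg, Polynomial.map_pow,
    map_X, Polynomial.map_ofNat, Polynomial.map_one, Int.cast_ofNat, map_ofNat]

/-- `X ^ 2 + 3 * X - 1` is monic over `𝔽₇`. [folklore] -/
theorem monic_quad_twentyfour_seven :
    ((X ^ 2 + 3 * X - 1 : ℤ[X]).map (Int.castRingHom (ZMod 7))).Monic := by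
  rw [map_quad_twentyfour_seven]
  monicity!

/-- `X ^ 2 + 3 * X - 1` has no root modulo `7`. [folklore] -/
theorem quad_twentyfour_seven_ne_zero : ∀ c : ZMod 7, c ^ 2 + 3 * c - 1 ≠ 0 := by
  decide

/-- `X ^ 2 + 3 * X - 1` is irreducible over `𝔽₇`. [folklore] -/
theorem irreducible_quad_twentyfour_seven :
    Irreducible ((X ^ 2 + 3 * X - 1 : ℤ[X]).map (Int.castRingHom (ZMod 7))) := by
  haveI := Fact.mk (show Nat.Prime 7 by norm_num)
  rw [map_quad_twentyfour_seven]
  have hdeg : (X ^ 2 + 3 * X - 1 : (ZMod 7)[X]).natDegree = 2 := by compute_degree!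
  refine irreducible_of_degree_le_three_of_not_isRoot (by rw [hdeg]; decide) fun c hc =>
    quad_twentyfour_seven_ne_zero c ?_
  have h := hc
  rw [IsRoot.def] at h
  simpa using h

set_option linter.unusedSimpArgs false in
/-- **The primes above `7`**: `(7, θ - 6)` (degree one) and `(7, θ ^ 2 + 3 * θ - 1)` (degree two). [folklore] -/
theorem eq_P7_or_eq_Q7_twentyfour (hθ : aeval θ (csPoly 24) = 0) (h3 : finrank ℚ K = 3)
    {P : Ideal (𝓞 K)} (hP : P ∈ primesOver (span {((7 : ℕ) : ℤ)}) (𝓞 K)) :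
    P = span {(7 : 𝓞 K), thetaInt hθ - 6} ∨
      P = span {(7 : 𝓞 K), thetaInt hθ ^ 2 + 3 * thetaInt hθ - 1} := by
  rcases eq_span_pair_of_linear_mul_quadratic_of_sq hθ h3 csDisc_twentyfour_sq (by norm_num)
    monic_quad_twentyfour_seven irreducible_quad_twentyfour_seven csPolyMod_twentyfour_seven hP with h | h
  · left; simpa using h
  · right
    simp only [map_add, map_sub, map_neg, map_mul, map_pow, aeval_X, map_ofNat, map_one] at h
    simpa using h

/-- `f₂₄ = (x - 3)(x^2 + x + 4) + 11(-2 * x^2 + 2 * x + 1)`: the factorisation modulo `11`. [folklore] -/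
theorem csPoly_twentyfour_eq_eleven :
    csPoly 24 = (X - 3) * (X ^ 2 + X + 4) + 11 * (-2 * X ^ 2 + 2 * X + 1) := by
  simp only [csPoly, map_sub, map_one, map_ofNat]
  ring

set_option linter.unusedSimpArgs false in
/-- The lift `X ^ 2 + X + 4` reduces modulo `11` to the same expression in `𝔽₁₁[x]`. [folklore] -/
theorem map_quad_twentyfour_eleven :
    (X ^ 2 + X + 4 : ℤ[X]).map (Int.castRingHom (ZMod 11)) = X ^ 2 + X + 4 := by
  simp only [Polynomial.map_add, Polynomial.map_sub, Polynomial.map_neg, Polynomial.map_mul, Polynomial.map_pow,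
    map_X, Polynomial.map_ofNat, Polynomial.map_one]

set_option linter.unusedSimpArgs false in
/-- `f₂₄ mod 11 = (x - 3)·(X ^ 2 + X + 4)`. [folklore] -/
theorem csPolyMod_twentyfour_eleven :
    csPolyMod 24 11 = (X - C ((3 : ℤ) : ZMod 11)) *
      (X ^ 2 + X + 4 : ℤ[X]).map (Int.castRingHom (ZMod 11)) := by
  rw [csPolyMod, csPoly_twentyfour_eq_eleven, Polynomial.map_add]
  have hp : Polynomial.map (Int.castRingHom (ZMod 11)) (11 * (-2 * X ^ 2 + 2 * X + 1) : ℤ[X]) = 0 := by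
    rw [Polynomial.map_mul, show (11 : ℤ[X]) = C 11 from rfl, Polynomial.map_C]
    have : (Int.castRingHom (ZMod 11)) 11 = 0 := by decide
    rw [this, C_0, zero_mul]
  rw [hp, add_zero, map_quad_twentyfour_eleven]
  simp only [Polynomial.map_mul, Polynomial.map_sub, Polynomial.map_add, Polynomial.map_neg, Polynomial.map_pow,
    map_X, Polynomial.map_ofNat, Polynomial.map_one, Int.cast_ofNat, map_ofNat]

/-- `X ^ 2 + X + 4` is monic over `𝔽₁₁`. [folklore] -/
theorem monic_quad_twentyfour_eleven :
    ((X ^ 2 + X + 4 : ℤ[X]).map (Int.castRingHom (ZMod 11))).Monic := by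
  rw [map_quad_twentyfour_eleven]
  monicity!

/-- `X ^ 2 + X + 4` has no root modulo `11`. [folklore] -/
theorem quad_twentyfour_eleven_ne_zero : ∀ c : ZMod 11, c ^ 2 + c + 4 ≠ 0 := by
  decide

/-- `X ^ 2 + X + 4` is irreducible over `𝔽₁₁`. [folklore] -/
theorem irreducible_quad_twentyfour_eleven :
    Irreducible ((X ^ 2 + X + 4 : ℤ[X]).map (Int.castRingHom (ZMod 11))) := by
  haveI := Fact.mk (show Nat.Prime 11 by norm_num)
  rw [map_quad_twentyfour_eleven]
  have hdeg : (X ^ 2 + X + 4 : (ZMod 11)[X]).natDegree = 2 := by compute_degree!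
  refine irreducible_of_degree_le_three_of_not_isRoot (by rw [hdeg]; decide) fun c hc =>
    quad_twentyfour_eleven_ne_zero c ?_
  have h := hc
  rw [IsRoot.def] at h
  simpa using h

set_option linter.unusedSimpArgs false in
/-- **The primes above `11`**: `(11, θ - 3)` (degree one) and `(11, θ ^ 2 + θ + 4)` (degree two). [folklore] -/
theorem eq_P11_or_eq_Q11_twentyfour (hθ : aeval θ (csPoly 24) = 0) (h3 : finrank ℚ K = 3)
    {P : Ideal (𝓞 K)} (hP : P ∈ primesOver (span {((11 : ℕ) : ℤ)}) (𝓞 K)) :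
    P = span {(11 : 𝓞 K), thetaInt hθ - 3} ∨
      P = span {(11 : 𝓞 K), thetaInt hθ ^ 2 + thetaInt hθ + 4} := by
  rcases eq_span_pair_of_linear_mul_quadratic_of_sq hθ h3 csDisc_twentyfour_sq (by norm_num)
    monic_quad_twentyfour_eleven irreducible_quad_twentyfour_eleven csPolyMod_twentyfour_eleven hP with h | h
  · left; simpa using h
  · right
    simp only [map_add, map_sub, map_neg, map_mul, map_pow, aeval_X, map_ofNat, map_one] at h
    simpa using h

/-- `f₂₄ = (x - 8)(x - 21)(x - 24) + 29(x^2 - 29 * x + 139)`: `f₂₄ ≡ (x - 8)(x - 21)(x - 24) (mod 29)`. [folklore] -/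
theorem csPoly_twentyfour_eq_twentynine :
    csPoly 24 = (X - 8) * (X - 21) * (X - 24) + 29 * (X ^ 2 - 29 * X + 139) := by
  simp only [csPoly, map_sub, map_one, map_ofNat]
  ring

/-- `f₂₄ mod 29 = (x - 8)(x - 21)(x - 24)`. [folklore] -/
theorem csPolyMod_twentyfour_twentynine :
    csPolyMod 24 29 = (X - C ((8 : ℤ) : ZMod 29)) * (X - C ((21 : ℤ) : ZMod 29)) *
      (X - C ((24 : ℤ) : ZMod 29)) := by
  rw [csPolyMod, csPoly_twentyfour_eq_twentynine, Polynomial.map_add]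
  have hp : Polynomial.map (Int.castRingHom (ZMod 29)) (29 * (X ^ 2 - 29 * X + 139) : ℤ[X]) = 0 := by
    rw [Polynomial.map_mul, show (29 : ℤ[X]) = C 29 from rfl, Polynomial.map_C]
    have : (Int.castRingHom (ZMod 29)) 29 = 0 := by decide
    rw [this, C_0, zero_mul]
  rw [hp, add_zero]
  simp only [Polynomial.map_mul, Polynomial.map_sub, map_X, Polynomial.map_ofNat, Int.cast_ofNat,
    map_ofNat]

/-- **The primes above `29`**: `(29, θ - 8)`, `(29, θ - 21)`, `(29, θ - 24)`. [folklore] -/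
theorem eq_P29_twentyfour (hθ : aeval θ (csPoly 24) = 0) (h3 : finrank ℚ K = 3)
    {P : Ideal (𝓞 K)} (hP : P ∈ primesOver (span {((29 : ℕ) : ℤ)}) (𝓞 K)) :
    P = span {(29 : 𝓞 K), thetaInt hθ - 8} ∨ P = span {(29 : 𝓞 K), thetaInt hθ - 21} ∨
      P = span {(29 : 𝓞 K), thetaInt hθ - 24} := by
  rcases eq_span_pair_of_split_of_sq hθ h3 csDisc_twentyfour_sq (by norm_num)
    csPolyMod_twentyfour_twentynine hP with h | h | h
  · left; simpa using h
  · right; left; simpa using h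
  · right; right; simpa using h

/-- `f₂₄ = (x - 15)(x - 16)(x - 34) + 41(x^2 - 31 * x + 199)`: `f₂₄ ≡ (x - 15)(x - 16)(x - 34) (mod 41)`. [folklore] -/
theorem csPoly_twentyfour_eq_fortyone :
    csPoly 24 = (X - 15) * (X - 16) * (X - 34) + 41 * (X ^ 2 - 31 * X + 199) := by
  simp only [csPoly, map_sub, map_one, map_ofNat]
  ring

/-- `f₂₄ mod 41 = (x - 15)(x - 16)(x - 34)`. [folklore] -/
theorem csPolyMod_twentyfour_fortyone :
    csPolyMod 24 41 = (X - C ((15 : ℤ) : ZMod 41)) * (X - C ((16 : ℤ) : ZMod 41)) *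
      (X - C ((34 : ℤ) : ZMod 41)) := by
  rw [csPolyMod, csPoly_twentyfour_eq_fortyone, Polynomial.map_add]
  have hp : Polynomial.map (Int.castRingHom (ZMod 41)) (41 * (X ^ 2 - 31 * X + 199) : ℤ[X]) = 0 := by
    rw [Polynomial.map_mul, show (41 : ℤ[X]) = C 41 from rfl, Polynomial.map_C]
    have : (Int.castRingHom (ZMod 41)) 41 = 0 := by decide
    rw [this, C_0, zero_mul]
  rw [hp, add_zero]
  simp only [Polynomial.map_mul, Polynomial.map_sub, map_X, Polynomial.map_ofNat, Int.cast_ofNat,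
    map_ofNat]

/-- **The primes above `41`**: `(41, θ - 15)`, `(41, θ - 16)`, `(41, θ - 34)`. [folklore] -/
theorem eq_P41_twentyfour (hθ : aeval θ (csPoly 24) = 0) (h3 : finrank ℚ K = 3)
    {P : Ideal (𝓞 K)} (hP : P ∈ primesOver (span {((41 : ℕ) : ℤ)}) (𝓞 K)) :
    P = span {(41 : 𝓞 K), thetaInt hθ - 15} ∨ P = span {(41 : 𝓞 K), thetaInt hθ - 16} ∨
      P = span {(41 : 𝓞 K), thetaInt hθ - 34} := by
  rcases eq_span_pair_of_split_of_sq hθ h3 csDisc_twentyfour_sq (by norm_num)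
    csPolyMod_twentyfour_fortyone hP with h | h | h
  · left; simpa using h
  · right; left; simpa using h
  · right; right; simpa using h

/-- `f₂₄ = (x - 2)(x - 31)(x - 34) + 43(x^2 - 27 * x + 49)`: `f₂₄ ≡ (x - 2)(x - 31)(x - 34) (mod 43)`. [folklore] -/
theorem csPoly_twentyfour_eq_fortythree :
    csPoly 24 = (X - 2) * (X - 31) * (X - 34) + 43 * (X ^ 2 - 27 * X + 49) := by
  simp only [csPoly, map_sub, map_one, map_ofNat]
  ring

/-- `f₂₄ mod 43 = (x - 2)(x - 31)(x - 34)`. [folklore] -/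
theorem csPolyMod_twentyfour_fortythree :
    csPolyMod 24 43 = (X - C ((2 : ℤ) : ZMod 43)) * (X - C ((31 : ℤ) : ZMod 43)) *
      (X - C ((34 : ℤ) : ZMod 43)) := by
  rw [csPolyMod, csPoly_twentyfour_eq_fortythree, Polynomial.map_add]
  have hp : Polynomial.map (Int.castRingHom (ZMod 43)) (43 * (X ^ 2 - 27 * X + 49) : ℤ[X]) = 0 := by
    rw [Polynomial.map_mul, show (43 : ℤ[X]) = C 43 from rfl, Polynomial.map_C]
    have : (Int.castRingHom (ZMod 43)) 43 = 0 := by decide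
    rw [this, C_0, zero_mul]
  rw [hp, add_zero]
  simp only [Polynomial.map_mul, Polynomial.map_sub, map_X, Polynomial.map_ofNat, Int.cast_ofNat,
    map_ofNat]

/-- **The primes above `43`**: `(43, θ - 2)`, `(43, θ - 31)`, `(43, θ - 34)`. [folklore] -/
theorem eq_P43_twentyfour (hθ : aeval θ (csPoly 24) = 0) (h3 : finrank ℚ K = 3)
    {P : Ideal (𝓞 K)} (hP : P ∈ primesOver (span {((43 : ℕ) : ℤ)}) (𝓞 K)) :
    P = span {(43 : 𝓞 K), thetaInt hθ - 2} ∨ P = span {(43 : 𝓞 K), thetaInt hθ - 31} ∨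
      P = span {(43 : 𝓞 K), thetaInt hθ - 34} := by
  rcases eq_span_pair_of_split_of_sq hθ h3 csDisc_twentyfour_sq (by norm_num)
    csPolyMod_twentyfour_fortythree hP with h | h | h
  · left; simpa using h
  · right; left; simpa using h
  · right; right; simpa using h

/-- `f₂₄ = (x - 44)(x - 56)(x - 58) + 67(2 * x^2 - 123 * x + 2133)`: `f₂₄ ≡ (x - 44)(x - 56)(x - 58) (mod 67)`. [folklore] -/
theorem csPoly_twentyfour_eq_sixtyseven :
    csPoly 24 = (X - 44) * (X - 56) * (X - 58) + 67 * (2 * X ^ 2 - 123 * X + 2133) := by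
  simp only [csPoly, map_sub, map_one, map_ofNat]
  ring

/-- `f₂₄ mod 67 = (x - 44)(x - 56)(x - 58)`. [folklore] -/
theorem csPolyMod_twentyfour_sixtyseven :
    csPolyMod 24 67 = (X - C ((44 : ℤ) : ZMod 67)) * (X - C ((56 : ℤ) : ZMod 67)) *
      (X - C ((58 : ℤ) : ZMod 67)) := by
  rw [csPolyMod, csPoly_twentyfour_eq_sixtyseven, Polynomial.map_add]
  have hp : Polynomial.map (Int.castRingHom (ZMod 67)) (67 * (2 * X ^ 2 - 123 * X + 2133) : ℤ[X]) = 0 := by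
    rw [Polynomial.map_mul, show (67 : ℤ[X]) = C 67 from rfl, Polynomial.map_C]
    have : (Int.castRingHom (ZMod 67)) 67 = 0 := by decide
    rw [this, C_0, zero_mul]
  rw [hp, add_zero]
  simp only [Polynomial.map_mul, Polynomial.map_sub, map_X, Polynomial.map_ofNat, Int.cast_ofNat,
    map_ofNat]

/-- **The primes above `67`**: `(67, θ - 44)`, `(67, θ - 56)`, `(67, θ - 58)`. [folklore] -/
theorem eq_P67_twentyfour (hθ : aeval θ (csPoly 24) = 0) (h3 : finrank ℚ K = 3)
    {P : Ideal (𝓞 K)} (hP : P ∈ primesOver (span {((67 : ℕ) : ℤ)}) (𝓞 K)) :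
    P = span {(67 : 𝓞 K), thetaInt hθ - 44} ∨ P = span {(67 : 𝓞 K), thetaInt hθ - 56} ∨
      P = span {(67 : 𝓞 K), thetaInt hθ - 58} := by
  rcases eq_span_pair_of_split_of_sq hθ h3 csDisc_twentyfour_sq (by norm_num)
    csPolyMod_twentyfour_sixtyseven hP with h | h | h
  · left; simpa using h
  · right; left; simpa using h
  · right; right; simpa using h

/-- `f₂₄ = (x - 67)(x - 76)(x - 87) + 103(2 * x^2 - 170 * x + 4301)`: `f₂₄ ≡ (x - 67)(x - 76)(x - 87) (mod 103)`. [folklore] -/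
theorem csPoly_twentyfour_eq_hundredthree :
    csPoly 24 = (X - 67) * (X - 76) * (X - 87) + 103 * (2 * X ^ 2 - 170 * X + 4301) := by
  simp only [csPoly, map_sub, map_one, map_ofNat]
  ring

/-- `f₂₄ mod 103 = (x - 67)(x - 76)(x - 87)`. [folklore] -/
theorem csPolyMod_twentyfour_hundredthree :
    csPolyMod 24 103 = (X - C ((67 : ℤ) : ZMod 103)) * (X - C ((76 : ℤ) : ZMod 103)) *
      (X - C ((87 : ℤ) : ZMod 103)) := by
  rw [csPolyMod, csPoly_twentyfour_eq_hundredthree, Polynomial.map_add]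
  have hp : Polynomial.map (Int.castRingHom (ZMod 103)) (103 * (2 * X ^ 2 - 170 * X + 4301) : ℤ[X]) = 0 := by
    rw [Polynomial.map_mul, show (103 : ℤ[X]) = C 103 from rfl, Polynomial.map_C]
    have : (Int.castRingHom (ZMod 103)) 103 = 0 := by decide
    rw [this, C_0, zero_mul]
  rw [hp, add_zero]
  simp only [Polynomial.map_mul, Polynomial.map_sub, map_X, Polynomial.map_ofNat, Int.cast_ofNat,
    map_ofNat]

/-- **The primes above `103`**: `(103, θ - 67)`, `(103, θ - 76)`, `(103, θ - 87)`. [folklore] -/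
theorem eq_P103_twentyfour (hθ : aeval θ (csPoly 24) = 0) (h3 : finrank ℚ K = 3)
    {P : Ideal (𝓞 K)} (hP : P ∈ primesOver (span {((103 : ℕ) : ℤ)}) (𝓞 K)) :
    P = span {(103 : 𝓞 K), thetaInt hθ - 67} ∨ P = span {(103 : 𝓞 K), thetaInt hθ - 76} ∨
      P = span {(103 : 𝓞 K), thetaInt hθ - 87} := by
  rcases eq_span_pair_of_split_of_sq hθ h3 csDisc_twentyfour_sq (by norm_num)
    csPolyMod_twentyfour_hundredthree hP with h | h | h
  · left; simpa using h
  · right; left; simpa using h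
  · right; right; simpa using h

/-- `f₂₄ = (x - 25)(x - 35)(x - 73) + 109(x^2 - 48 * x + 586)`: `f₂₄ ≡ (x - 25)(x - 35)(x - 73) (mod 109)`. [folklore] -/
theorem csPoly_twentyfour_eq_hundrednine :
    csPoly 24 = (X - 25) * (X - 35) * (X - 73) + 109 * (X ^ 2 - 48 * X + 586) := by
  simp only [csPoly, map_sub, map_one, map_ofNat]
  ring

/-- `f₂₄ mod 109 = (x - 25)(x - 35)(x - 73)`. [folklore] -/
theorem csPolyMod_twentyfour_hundrednine :
    csPolyMod 24 109 = (X - C ((25 : ℤ) : ZMod 109)) * (X - C ((35 : ℤ) : ZMod 109)) *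
      (X - C ((73 : ℤ) : ZMod 109)) := by
  rw [csPolyMod, csPoly_twentyfour_eq_hundrednine, Polynomial.map_add]
  have hp : Polynomial.map (Int.castRingHom (ZMod 109)) (109 * (X ^ 2 - 48 * X + 586) : ℤ[X]) = 0 := by
    rw [Polynomial.map_mul, show (109 : ℤ[X]) = C 109 from rfl, Polynomial.map_C]
    have : (Int.castRingHom (ZMod 109)) 109 = 0 := by decide
    rw [this, C_0, zero_mul]
  rw [hp, add_zero]
  simp only [Polynomial.map_mul, Polynomial.map_sub, map_X, Polynomial.map_ofNat, Int.cast_ofNat,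
    map_ofNat]

/-- **The primes above `109`**: `(109, θ - 25)`, `(109, θ - 35)`, `(109, θ - 73)`. [folklore] -/
theorem eq_P109_twentyfour (hθ : aeval θ (csPoly 24) = 0) (h3 : finrank ℚ K = 3)
    {P : Ideal (𝓞 K)} (hP : P ∈ primesOver (span {((109 : ℕ) : ℤ)}) (𝓞 K)) :
    P = span {(109 : 𝓞 K), thetaInt hθ - 25} ∨ P = span {(109 : 𝓞 K), thetaInt hθ - 35} ∨
      P = span {(109 : 𝓞 K), thetaInt hθ - 73} := by
  rcases eq_span_pair_of_split_of_sq hθ h3 csDisc_twentyfour_sq (by norm_num)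
    csPolyMod_twentyfour_hundrednine hP with h | h | h
  · left; simpa using h
  · right; left; simpa using h
  · right; right; simpa using h

/-! ### Relations among the small primes: explicit generators -/

/-- **`𝔭₇² = (θ + 1)`** (`N(θ + 1) = 49`): `[𝔭₇]² = 1`. [folklore] -/
theorem P7_mul_P7_twentyfour (hθ : aeval θ (csPoly 24) = 0) :
    span {(7 : 𝓞 K), thetaInt hθ - 6} * span {(7 : 𝓞 K), thetaInt hθ - 6} =
      span {thetaInt hθ + 1} := by
  have rel := thetaInt_rel_twentyfour hθ
  set t := thetaInt hθ with ht
  exact span_pair_mul_span_pair_eq_span_singleton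
    (δ₁ := t ^ 2 - 25 * t + 48) (δ₂ := -t ^ 2 + 25 * t - 41)
    (δ₃ := -t ^ 2 + 25 * t - 41) (δ₄ := t ^ 2 - 24 * t + 35)
    (u₁ := 1272 * t ^ 2) (u₂ := -1380 * t - 84) (u₃ := 0) (u₄ := -4391 * t + 24)
    (by linear_combination (-1 : 𝓞 K) * rel) (by linear_combination (1 : 𝓞 K) * rel)
    (by linear_combination (1 : 𝓞 K) * rel) (by linear_combination (-1 : 𝓞 K) * rel)
    (by linear_combination (4391 : 𝓞 K) * rel)

/-- **`𝔭₁₁² = (θ - 3)`** (`N(θ - 3) = 121`): `[𝔭₁₁]² = 1`. [folklore] -/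
theorem P11_mul_P11_twentyfour (hθ : aeval θ (csPoly 24) = 0) :
    span {(11 : 𝓞 K), thetaInt hθ - 3} * span {(11 : 𝓞 K), thetaInt hθ - 3} =
      span {thetaInt hθ - 3} := by
  have rel := thetaInt_rel_twentyfour hθ
  set t := thetaInt hθ with ht
  exact span_pair_mul_span_pair_eq_span_singleton
    (δ₁ := t ^ 2 - 21 * t - 40) (δ₂ := 11)
    (δ₃ := 11) (δ₄ := t - 3)
    (u₁ := -109 * t ^ 2) (u₂ := -1148 * t) (u₃ := 0) (u₄ := 205 * t ^ 2 - 3324 * t - 41)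
    (by linear_combination (-1 : 𝓞 K) * rel) (by ring)
    (by ring) (by ring)
    (by linear_combination (-205 * t - 366) * rel)

/-- **`𝔭₇ 𝔭₁₁ = (77, θ - 69)`** (`69 ≡ 6 (mod 7)`, `69 ≡ 3 (mod 11)`). [folklore] -/
theorem P7_mul_P11_twentyfour (hθ : aeval θ (csPoly 24) = 0) :
    span {(7 : 𝓞 K), thetaInt hθ - 6} * span {(11 : 𝓞 K), thetaInt hθ - 3} =
      span {(77 : 𝓞 K), thetaInt hθ - 69} := by
  have rel := thetaInt_rel_twentyfour hθ
  set t := thetaInt hθ with ht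
  exact span_pair_mul_span_pair_eq_span_pair
    (α₁ := 1) (β₁ := 0)
    (α₂ := 6) (β₂ := 7)
    (α₃ := 9) (β₃ := 11)
    (α₄ := 16463 * t ^ 2) (β₄ := 27963 * t ^ 2 - 9315 * t + 405)
    (u₁ := 1) (u₂ := 0) (u₃ := 0) (u₄ := 0)
    (v₁ := 0) (v₂ := -3) (v₃ := 2) (v₄ := 0)
    (by ring) (by ring) (by ring) (by linear_combination (-27963 : 𝓞 K) * rel)
    (by ring) (by ring)

/-- **`(77, θ - 69) 𝔭₂₃ = (2θ² - 3θ + 2)`** (`N = 1771 = 7·11·23`): `[𝔭₂₃] = [𝔭₇][𝔭₁₁]`. [folklore] -/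
theorem I77_mul_P23_twentyfour (hθ : aeval θ (csPoly 24) = 0) :
    span {(77 : 𝓞 K), thetaInt hθ - 69} * span {(23 : 𝓞 K), thetaInt hθ - 17} =
      span {2 * thetaInt hθ ^ 2 - 3 * thetaInt hθ + 2} := by
  have rel := thetaInt_rel_twentyfour hθ
  set t := thetaInt hθ with ht
  exact span_pair_mul_span_pair_eq_span_singleton
    (δ₁ := -47 * t ^ 2 + 1042 * t + 901) (δ₂ := 31 * t ^ 2 - 684 * t - 668)
    (δ₃ := 41 * t ^ 2 - 908 * t - 808) (δ₄ := -27 * t ^ 2 + 595 * t + 599)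
    (u₁ := 3) (u₂ := 1) (u₃ := 4) (u₄ := 2)
    (by linear_combination (94 * t + 31) * rel) (by linear_combination (-62 * t - 27) * rel)
    (by linear_combination (-82 * t - 29) * rel) (by linear_combination (54 * t + 25) * rel)
    (by ring)

/-- **`𝔭₇ 𝔮₄₉ = (7)`**, `𝔮₄₉` the prime of degree two above `7`. [folklore] -/
theorem P7_mul_Q7_twentyfour (hθ : aeval θ (csPoly 24) = 0) :
    span {(7 : 𝓞 K), thetaInt hθ - 6} * span {(7 : 𝓞 K), thetaInt hθ ^ 2 + 3 * thetaInt hθ - 1} =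
      span {7} := by
  have rel := thetaInt_rel_twentyfour hθ
  set t := thetaInt hθ with ht
  exact span_pair_mul_span_pair_eq_span_singleton
    (δ₁ := 7) (δ₂ := t ^ 2 + 3 * t - 1)
    (δ₃ := t - 6) (δ₄ := 3 * t ^ 2 - 6 * t + 1)
    (u₁ := 5200 * t ^ 2) (u₂ := 3 * t ^ 2 - 78044) (u₃ := 0) (u₄ := 208 * t ^ 2 - 91852)
    (by ring) (by ring)
    (by ring) (by linear_combination (1 : 𝓞 K) * rel)
    (by linear_combination (-208 * t ^ 2 - 4389 * t - 4811) * rel)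

/-- **`𝔭₁₁ 𝔮₁₂₁ = (11)`**, `𝔮₁₂₁` the prime of degree two above `11`. [folklore] -/
theorem P11_mul_Q11_twentyfour (hθ : aeval θ (csPoly 24) = 0) :
    span {(11 : 𝓞 K), thetaInt hθ - 3} * span {(11 : 𝓞 K), thetaInt hθ ^ 2 + thetaInt hθ + 4} =
      span {11} := by
  have rel := thetaInt_rel_twentyfour hθ
  set t := thetaInt hθ with ht
  exact span_pair_mul_span_pair_eq_span_singleton
    (δ₁ := 11) (δ₂ := t ^ 2 + t + 4)
    (δ₃ := t - 3) (δ₄ := 2 * t ^ 2 - 2 * t - 1)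
    (u₁ := 2) (u₂ := -2) (u₃ := 4) (u₄ := 1)
    (by ring) (by ring)
    (by ring) (by linear_combination (1 : 𝓞 K) * rel)
    (by linear_combination (-1 : 𝓞 K) * rel)

/-- **`𝔭₁₁ 𝔭₁₉ = (4θ - 1)`** (`N = -209`). [folklore] -/
theorem P11_mul_P19_twentyfour (hθ : aeval θ (csPoly 24) = 0) :
    span {(11 : 𝓞 K), thetaInt hθ - 3} * span {(19 : 𝓞 K), thetaInt hθ - 5} =
      span {4 * thetaInt hθ - 1} := by
  have rel := thetaInt_rel_twentyfour hθ
  set t := thetaInt hθ with ht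
  exact span_pair_mul_span_pair_eq_span_singleton
    (δ₁ := -16 * t ^ 2 + 380 * t - 273) (δ₂ := 4 * t ^ 2 - 95 * t + 71)
    (δ₃ := 4 * t ^ 2 - 95 * t + 73) (δ₄ := -t ^ 2 + 24 * t - 19)
    (u₁ := 1) (u₂ := 9) (u₃ := -5) (u₄ := 0)
    (by linear_combination (64 : 𝓞 K) * rel) (by linear_combination (-16 : 𝓞 K) * rel)
    (by linear_combination (-16 : 𝓞 K) * rel) (by linear_combination (4 : 𝓞 K) * rel)
    (by ring)

/-- **`𝔭₇ (29, θ - 8) = (4θ - 3)`** (`N = -203`). [folklore] -/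
theorem P7_mul_P29a_twentyfour (hθ : aeval θ (csPoly 24) = 0) :
    span {(7 : 𝓞 K), thetaInt hθ - 6} * span {(29 : 𝓞 K), thetaInt hθ - 8} =
      span {4 * thetaInt hθ - 3} := by
  have rel := thetaInt_rel_twentyfour hθ
  set t := thetaInt hθ with ht
  exact span_pair_mul_span_pair_eq_span_singleton
    (δ₁ := -16 * t ^ 2 + 372 * t - 89) (δ₂ := 4 * t ^ 2 - 93 * t + 24)
    (δ₃ := 12 * t ^ 2 - 279 * t + 74) (δ₄ := -3 * t ^ 2 + 70 * t - 20)
    (u₁ := 1) (u₂ := 13) (u₃ := -3) (u₄ := 0)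
    (by linear_combination (64 : 𝓞 K) * rel) (by linear_combination (-16 : 𝓞 K) * rel)
    (by linear_combination (-48 : 𝓞 K) * rel) (by linear_combination (12 : 𝓞 K) * rel)
    (by ring)

/-- **`𝔭₂₃ (29, θ - 21) = (3θ - 5)`** (`N = 667`). [folklore] -/
theorem P23_mul_P29b_twentyfour (hθ : aeval θ (csPoly 24) = 0) :
    span {(23 : 𝓞 K), thetaInt hθ - 17} * span {(29 : 𝓞 K), thetaInt hθ - 21} =
      span {3 * thetaInt hθ - 5} := by
  have rel := thetaInt_rel_twentyfour hθ
  set t := thetaInt hθ with ht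
  exact span_pair_mul_span_pair_eq_span_singleton
    (δ₁ := 9 * t ^ 2 - 201 * t - 128) (δ₂ := -6 * t ^ 2 + 134 * t + 93)
    (δ₃ := -6 * t ^ 2 + 134 * t + 95) (δ₄ := 4 * t ^ 2 - 89 * t - 69)
    (u₁ := 2) (u₂ := 14) (u₃ := -11) (u₄ := 0)
    (by linear_combination (-27 : 𝓞 K) * rel) (by linear_combination (18 : 𝓞 K) * rel)
    (by linear_combination (18 : 𝓞 K) * rel) (by linear_combination (-12 : 𝓞 K) * rel)
    (by ring)

/-- **`𝔭₁₁ (29, θ - 24) = (5θ - 4)`** (`N = -319`). [folklore] -/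
theorem P11_mul_P29c_twentyfour (hθ : aeval θ (csPoly 24) = 0) :
    span {(11 : 𝓞 K), thetaInt hθ - 3} * span {(29 : 𝓞 K), thetaInt hθ - 24} =
      span {5 * thetaInt hθ - 4} := by
  have rel := thetaInt_rel_twentyfour hθ
  set t := thetaInt hθ with ht
  exact span_pair_mul_span_pair_eq_span_singleton
    (δ₁ := -25 * t ^ 2 + 580 * t - 111) (δ₂ := 20 * t ^ 2 - 464 * t + 91)
    (δ₃ := 5 * t ^ 2 - 116 * t + 28) (δ₄ := -4 * t ^ 2 + 93 * t - 23)
    (u₁ := 8) (u₂ := 11) (u₃ := -4) (u₄ := 0)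
    (by linear_combination (125 : 𝓞 K) * rel) (by linear_combination (-100 : 𝓞 K) * rel)
    (by linear_combination (-25 : 𝓞 K) * rel) (by linear_combination (20 : 𝓞 K) * rel)
    (by ring)

/-- **`𝔭₃₇ = (37, θ - 19) = (2θ - 1)` is principal** (`N(2θ - 1) = -37`). [folklore] -/
theorem P37_eq_twentyfour (hθ : aeval θ (csPoly 24) = 0) :
    span {(37 : 𝓞 K), thetaInt hθ - 19} = span {2 * thetaInt hθ - 1} := by
  have rel := thetaInt_rel_twentyfour hθ
  set t := thetaInt hθ with ht
  exact span_pair_eq_span_singleton (u := 1) (v := 2) (δ := -4 * t ^ 2 + 94 * t - 45)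
    (ε := 2 * t ^ 2 - 47 * t + 23)
    (by ring) (by linear_combination (8 : 𝓞 K) * rel) (by linear_combination (-4 : 𝓞 K) * rel)

/-- **`𝔭₇ (41, θ - 15) = (3θ - 4)`** (`N = 287`). [folklore] -/
theorem P7_mul_P41a_twentyfour (hθ : aeval θ (csPoly 24) = 0) :
    span {(7 : 𝓞 K), thetaInt hθ - 6} * span {(41 : 𝓞 K), thetaInt hθ - 15} =
      span {3 * thetaInt hθ - 4} := by
  have rel := thetaInt_rel_twentyfour hθ
  set t := thetaInt hθ with ht
  exact span_pair_mul_span_pair_eq_span_singleton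
    (δ₁ := 9 * t ^ 2 - 204 * t - 65) (δ₂ := -3 * t ^ 2 + 68 * t + 24)
    (δ₃ := -6 * t ^ 2 + 136 * t + 57) (δ₄ := 2 * t ^ 2 - 45 * t - 21)
    (u₁ := 4) (u₂ := 18) (u₃ := -3) (u₄ := 0)
    (by linear_combination (-27 : 𝓞 K) * rel) (by linear_combination (9 : 𝓞 K) * rel)
    (by linear_combination (18 : 𝓞 K) * rel) (by linear_combination (-6 : 𝓞 K) * rel)
    (by ring)

/-- **`𝔭₂₃ (41, θ - 16) = (θ² + 2θ - 1)`** (`N = -943`). [folklore] -/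
theorem P23_mul_P41b_twentyfour (hθ : aeval θ (csPoly 24) = 0) :
    span {(23 : 𝓞 K), thetaInt hθ - 17} * span {(41 : 𝓞 K), thetaInt hθ - 16} =
      span {thetaInt hθ ^ 2 + 2 * thetaInt hθ - 1} := by
  have rel := thetaInt_rel_twentyfour hθ
  set t := thetaInt hθ with ht
  exact span_pair_mul_span_pair_eq_span_singleton
    (δ₁ := -76 * t ^ 2 + 1797 * t - 1122) (δ₂ := 29 * t ^ 2 - 686 * t + 436)
    (δ₃ := 55 * t ^ 2 - 1301 * t + 826) (δ₄ := -21 * t ^ 2 + 497 * t - 321)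
    (u₁ := 0) (u₂ := 14) (u₃ := -7) (u₄ := 1)
    (by linear_combination (76 * t + 179) * rel) (by linear_combination (-29 * t - 68) * rel)
    (by linear_combination (-55 * t - 129) * rel) (by linear_combination (21 * t + 49) * rel)
    (by ring)

/-- **`𝔭₁₁ (41, θ - 34) = (θ² + θ - 1)`** (`N = -451`). [folklore] -/
theorem P11_mul_P41c_twentyfour (hθ : aeval θ (csPoly 24) = 0) :
    span {(11 : 𝓞 K), thetaInt hθ - 3} * span {(41 : 𝓞 K), thetaInt hθ - 34} =
      span {thetaInt hθ ^ 2 + thetaInt hθ - 1} := by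
  have rel := thetaInt_rel_twentyfour hθ
  set t := thetaInt hθ with ht
  exact span_pair_mul_span_pair_eq_span_singleton
    (δ₁ := -49 * t ^ 2 + 1150 * t - 526) (δ₂ := 40 * t ^ 2 - 939 * t + 435)
    (δ₃ := 11 * t ^ 2 - 259 * t + 139) (δ₄ := -9 * t ^ 2 + 212 * t - 115)
    (u₁ := -3) (u₂ := -4) (u₃ := 2) (u₄ := 1)
    (by linear_combination (49 * t + 75) * rel) (by linear_combination (-40 * t - 61) * rel)
    (by linear_combination (-11 * t - 16) * rel) (by linear_combination (9 * t + 13) * rel)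
    (by ring)

/-- **`(43, θ - 2) = (θ - 2)` is principal** (`N(θ - 2) = 43`). [folklore] -/
theorem P43a_eq_twentyfour (hθ : aeval θ (csPoly 24) = 0) :
    span {(43 : 𝓞 K), thetaInt hθ - 2} = span {thetaInt hθ - 2} := by
  have rel := thetaInt_rel_twentyfour hθ
  set t := thetaInt hθ with ht
  exact span_pair_eq_span_singleton (u := 0) (v := 1) (δ := t ^ 2 - 22 * t - 21)
    (ε := 1)
    (by ring) (by linear_combination (-1 : 𝓞 K) * rel) (by ring)

/-- **`(41, θ - 16)(43, θ - 31) = (3θ - 7)`** (`N = 1763`). [folklore] -/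
theorem P41b_mul_P43b_twentyfour (hθ : aeval θ (csPoly 24) = 0) :
    span {(41 : 𝓞 K), thetaInt hθ - 16} * span {(43 : 𝓞 K), thetaInt hθ - 31} =
      span {3 * thetaInt hθ - 7} := by
  have rel := thetaInt_rel_twentyfour hθ
  set t := thetaInt hθ with ht
  exact span_pair_mul_span_pair_eq_span_singleton
    (δ₁ := 9 * t ^ 2 - 195 * t - 248) (δ₂ := -6 * t ^ 2 + 130 * t + 179)
    (δ₃ := -3 * t ^ 2 + 65 * t + 97) (δ₄ := 2 * t ^ 2 - 43 * t - 70)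
    (u₁ := 7) (u₂ := 20) (u₃ := -19) (u₄ := 0)
    (by linear_combination (-27 : 𝓞 K) * rel) (by linear_combination (18 : 𝓞 K) * rel)
    (by linear_combination (9 : 𝓞 K) * rel) (by linear_combination (-6 : 𝓞 K) * rel)
    (by ring)

/-- **`𝔭₂₃ (43, θ - 34) = (θ² - 5θ + 3)`** (`N = -989`). [folklore] -/
theorem P23_mul_P43c_twentyfour (hθ : aeval θ (csPoly 24) = 0) :
    span {(23 : 𝓞 K), thetaInt hθ - 17} * span {(43 : 𝓞 K), thetaInt hθ - 34} =
      span {thetaInt hθ ^ 2 - 5 * thetaInt hθ + 3} := by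
  have rel := thetaInt_rel_twentyfour hθ
  set t := thetaInt hθ with ht
  exact span_pair_mul_span_pair_eq_span_singleton
    (δ₁ := 75 * t ^ 2 - 1744 * t + 436) (δ₂ := -58 * t ^ 2 + 1349 * t - 343)
    (δ₃ := -53 * t ^ 2 + 1233 * t - 319) (δ₄ := 41 * t ^ 2 - 954 * t + 251)
    (u₁ := 1) (u₂ := 2) (u₃ := 0) (u₄ := 1)
    (by linear_combination (-75 * t + 319) * rel) (by linear_combination (58 * t - 247) * rel)
    (by linear_combination (53 * t - 226) * rel) (by linear_combination (-41 * t + 175) * rel)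
    (by ring)

/-- **`𝔭₂₃ 𝔭₅₃ = (θ + 6)`** (`N = 1219`). [folklore] -/
theorem P23_mul_P53_twentyfour (hθ : aeval θ (csPoly 24) = 0) :
    span {(23 : 𝓞 K), thetaInt hθ - 17} * span {(53 : 𝓞 K), thetaInt hθ - 47} =
      span {thetaInt hθ + 6} := by
  have rel := thetaInt_rel_twentyfour hθ
  set t := thetaInt hθ with ht
  exact span_pair_mul_span_pair_eq_span_singleton
    (δ₁ := t ^ 2 - 30 * t + 203) (δ₂ := -t ^ 2 + 30 * t - 180)
    (δ₃ := -t ^ 2 + 30 * t - 150) (δ₄ := t ^ 2 - 29 * t + 133)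
    (u₁ := -13) (u₂ := -23) (u₃ := 10) (u₄ := 0)
    (by linear_combination (-1 : 𝓞 K) * rel) (by linear_combination (1 : 𝓞 K) * rel)
    (by linear_combination (1 : 𝓞 K) * rel) (by linear_combination (-1 : 𝓞 K) * rel)
    (by ring)

/-- **`𝔭₁₁ (67, θ - 44) = (3θ + 2)`** (`N = 737`). [folklore] -/
theorem P11_mul_P67a_twentyfour (hθ : aeval θ (csPoly 24) = 0) :
    span {(11 : 𝓞 K), thetaInt hθ - 3} * span {(67 : 𝓞 K), thetaInt hθ - 44} =
      span {3 * thetaInt hθ + 2} := by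
  have rel := thetaInt_rel_twentyfour hθ
  set t := thetaInt hθ with ht
  exact span_pair_mul_span_pair_eq_span_singleton
    (δ₁ := 9 * t ^ 2 - 222 * t + 355) (δ₂ := -6 * t ^ 2 + 148 * t - 233)
    (δ₃ := -3 * t ^ 2 + 74 * t - 96) (δ₄ := 2 * t ^ 2 - 49 * t + 63)
    (u₁ := -11) (u₂ := -18) (u₃ := 3) (u₄ := 0)
    (by linear_combination (-27 : 𝓞 K) * rel) (by linear_combination (18 : 𝓞 K) * rel)
    (by linear_combination (9 : 𝓞 K) * rel) (by linear_combination (-6 : 𝓞 K) * rel)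
    (by ring)

/-- **`𝔭₇ (67, θ - 56) = (6θ - 1)`** (`N = -469`). [folklore] -/
theorem P7_mul_P67b_twentyfour (hθ : aeval θ (csPoly 24) = 0) :
    span {(7 : 𝓞 K), thetaInt hθ - 6} * span {(67 : 𝓞 K), thetaInt hθ - 56} =
      span {6 * thetaInt hθ - 1} := by
  have rel := thetaInt_rel_twentyfour hθ
  set t := thetaInt hθ with ht
  exact span_pair_mul_span_pair_eq_span_singleton
    (δ₁ := -36 * t ^ 2 + 858 * t - 685) (δ₂ := 30 * t ^ 2 - 715 * t + 572)
    (δ₃ := 30 * t ^ 2 - 715 * t + 582) (δ₄ := -25 * t ^ 2 + 596 * t - 486)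
    (u₁ := 15) (u₂ := 20) (u₃ := -2) (u₄ := 0)
    (by linear_combination (216 : 𝓞 K) * rel) (by linear_combination (-180 : 𝓞 K) * rel)
    (by linear_combination (-180 : 𝓞 K) * rel) (by linear_combination (150 : 𝓞 K) * rel)
    (by ring)

/-- **`𝔭₂₃ (67, θ - 58) = (7θ - 4)`** (`N = -1541`). [folklore] -/
theorem P23_mul_P67c_twentyfour (hθ : aeval θ (csPoly 24) = 0) :
    span {(23 : 𝓞 K), thetaInt hθ - 17} * span {(67 : 𝓞 K), thetaInt hθ - 58} =
      span {7 * thetaInt hθ - 4} := by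
  have rel := thetaInt_rel_twentyfour hθ
  set t := thetaInt hθ with ht
  exact span_pair_mul_span_pair_eq_span_singleton
    (δ₁ := -49 * t ^ 2 + 1148 * t - 471) (δ₂ := 42 * t ^ 2 - 984 * t + 407)
    (δ₃ := 35 * t ^ 2 - 820 * t + 346) (δ₄ := -30 * t ^ 2 + 703 * t - 299)
    (u₁ := -14) (u₂ := -23) (u₃ := 8) (u₄ := 0)
    (by linear_combination (343 : 𝓞 K) * rel) (by linear_combination (-294 : 𝓞 K) * rel)
    (by linear_combination (-245 : 𝓞 K) * rel) (by linear_combination (210 : 𝓞 K) * rel)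
    (by ring)

/-- **`𝔭₂₃ 𝔭₇₁ = (θ - 17)`** (`N = 1633`). [folklore] -/
theorem P23_mul_P71_twentyfour (hθ : aeval θ (csPoly 24) = 0) :
    span {(23 : 𝓞 K), thetaInt hθ - 17} * span {(71 : 𝓞 K), thetaInt hθ - 17} =
      span {thetaInt hθ - 17} := by
  have rel := thetaInt_rel_twentyfour hθ
  set t := thetaInt hθ with ht
  exact span_pair_mul_span_pair_eq_span_singleton
    (δ₁ := t ^ 2 - 7 * t - 96) (δ₂ := 23)
    (δ₃ := 71) (δ₄ := t - 17)
    (u₁ := 0) (u₂ := 34) (u₃ := -11) (u₄ := 0)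
    (by linear_combination (-1 : 𝓞 K) * rel) (by ring)
    (by ring) (by ring)
    (by ring)

/-- **`𝔭₇ 𝔭₇₃ = (θ - 6)`** (`N = 511`). [folklore] -/
theorem P7_mul_P73_twentyfour (hθ : aeval θ (csPoly 24) = 0) :
    span {(7 : 𝓞 K), thetaInt hθ - 6} * span {(73 : 𝓞 K), thetaInt hθ - 6} =
      span {thetaInt hθ - 6} := by
  have rel := thetaInt_rel_twentyfour hθ
  set t := thetaInt hθ with ht
  exact span_pair_mul_span_pair_eq_span_singleton
    (δ₁ := t ^ 2 - 18 * t - 85) (δ₂ := 7)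
    (δ₃ := 73) (δ₄ := t - 6)
    (u₁ := 0) (u₂ := 21) (u₃ := -2) (u₄ := 0)
    (by linear_combination (-1 : 𝓞 K) * rel) (by ring)
    (by ring) (by ring)
    (by ring)

/-- **`𝔭₇ 𝔭₇₉ = (5θ - 2)`** (`N = -553`). [folklore] -/
theorem P7_mul_P79_twentyfour (hθ : aeval θ (csPoly 24) = 0) :
    span {(7 : 𝓞 K), thetaInt hθ - 6} * span {(79 : 𝓞 K), thetaInt hθ - 32} =
      span {5 * thetaInt hθ - 2} := by
  have rel := thetaInt_rel_twentyfour hθ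
  set t := thetaInt hθ with ht
  exact span_pair_mul_span_pair_eq_span_singleton
    (δ₁ := -25 * t ^ 2 + 590 * t - 339) (δ₂ := 10 * t ^ 2 - 236 * t + 137)
    (δ₃ := 20 * t ^ 2 - 472 * t + 287) (δ₄ := -8 * t ^ 2 + 189 * t - 116)
    (u₁ := 4) (u₂ := 12) (u₃ := -1) (u₄ := 0)
    (by linear_combination (125 : 𝓞 K) * rel) (by linear_combination (-50 : 𝓞 K) * rel)
    (by linear_combination (-100 : 𝓞 K) * rel) (by linear_combination (40 : 𝓞 K) * rel)
    (by ring)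

/-- **`𝔭₇ 𝔭₈₉ = (2θ - 5)`** (`N = 623`). [folklore] -/
theorem P7_mul_P89_twentyfour (hθ : aeval θ (csPoly 24) = 0) :
    span {(7 : 𝓞 K), thetaInt hθ - 6} * span {(89 : 𝓞 K), thetaInt hθ - 47} =
      span {2 * thetaInt hθ - 5} := by
  have rel := thetaInt_rel_twentyfour hθ
  set t := thetaInt hθ with ht
  exact span_pair_mul_span_pair_eq_span_singleton
    (δ₁ := 4 * t ^ 2 - 86 * t - 123) (δ₂ := -2 * t ^ 2 + 43 * t + 65)
    (δ₃ := -2 * t ^ 2 + 43 * t + 106) (δ₄ := t ^ 2 - 21 * t - 56)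
    (u₁ := 6) (u₂ := 13) (u₃ := -1) (u₄ := 0)
    (by linear_combination (-8 : 𝓞 K) * rel) (by linear_combination (4 : 𝓞 K) * rel)
    (by linear_combination (4 : 𝓞 K) * rel) (by linear_combination (-2 : 𝓞 K) * rel)
    (by ring)

/-- **`𝔭₇ (103, θ - 67) = (θ² - 4θ + 2)`** (`N = -721`). [folklore] -/
theorem P7_mul_P103a_twentyfour (hθ : aeval θ (csPoly 24) = 0) :
    span {(7 : 𝓞 K), thetaInt hθ - 6} * span {(103 : 𝓞 K), thetaInt hθ - 67} =
      span {thetaInt hθ ^ 2 - 4 * thetaInt hθ + 2} := by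
  have rel := thetaInt_rel_twentyfour hθ
  set t := thetaInt hθ with ht
  exact span_pair_mul_span_pair_eq_span_singleton
    (δ₁ := 59 * t ^ 2 - 1377 * t + 459) (δ₂ := -38 * t ^ 2 + 887 * t - 298)
    (δ₃ := -45 * t ^ 2 + 1052 * t - 385) (δ₄ := 29 * t ^ 2 - 678 * t + 250)
    (u₁ := -29) (u₂ := -49) (u₃ := 4) (u₄ := 1)
    (by linear_combination (-59 * t + 197) * rel) (by linear_combination (38 * t - 127) * rel)
    (by linear_combination (45 * t - 152) * rel) (by linear_combination (-29 * t + 98) * rel)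
    (by ring)

/-- **`𝔭₂₃ (103, θ - 76) = (θ² + 15θ - 15)`** (`N = -2369`). [folklore] -/
theorem P23_mul_P103b_twentyfour (hθ : aeval θ (csPoly 24) = 0) :
    span {(23 : 𝓞 K), thetaInt hθ - 17} * span {(103 : 𝓞 K), thetaInt hθ - 76} =
      span {thetaInt hθ ^ 2 + 15 * thetaInt hθ - 15} := by
  have rel := thetaInt_rel_twentyfour hθ
  set t := thetaInt hθ with ht
  exact span_pair_mul_span_pair_eq_span_singleton
    (δ₁ := -623 * t ^ 2 + 14366 * t - 820) (δ₂ := 454 * t ^ 2 - 10469 * t + 599)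
    (δ₃ := 435 * t ^ 2 - 10031 * t + 579) (δ₄ := -317 * t ^ 2 + 7310 * t - 423)
    (u₁ := 26) (u₂ := 45) (u₃ := -9) (u₄ := 1)
    (by linear_combination (623 * t + 9931) * rel) (by linear_combination (-454 * t - 7237) * rel)
    (by linear_combination (-435 * t - 6934) * rel) (by linear_combination (317 * t + 5053) * rel)
    (by ring)

/-- **`𝔭₁₁ (103, θ - 87) = (6θ - 7)`** (`N = 1133`). [folklore] -/
theorem P11_mul_P103c_twentyfour (hθ : aeval θ (csPoly 24) = 0) :
    span {(11 : 𝓞 K), thetaInt hθ - 3} * span {(103 : 𝓞 K), thetaInt hθ - 87} =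
      span {6 * thetaInt hθ - 7} := by
  have rel := thetaInt_rel_twentyfour hθ
  set t := thetaInt hθ with ht
  exact span_pair_mul_span_pair_eq_span_singleton
    (δ₁ := 36 * t ^ 2 - 822 * t - 131) (δ₂ := -30 * t ^ 2 + 685 * t + 111)
    (δ₃ := -6 * t ^ 2 + 137 * t + 39) (δ₄ := 5 * t ^ 2 - 114 * t - 33)
    (u₁ := 31) (u₂ := 38) (u₃ := -4) (u₄ := 0)
    (by linear_combination (-216 : 𝓞 K) * rel) (by linear_combination (180 : 𝓞 K) * rel)
    (by linear_combination (36 : 𝓞 K) * rel) (by linear_combination (-30 : 𝓞 K) * rel)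
    (by ring)

/-- **`𝔭₁₀₇ = (107, θ - 72) = (3θ - 2)` is principal** (`N(3θ - 2) = -107`). [folklore] -/
theorem P107_eq_twentyfour (hθ : aeval θ (csPoly 24) = 0) :
    span {(107 : 𝓞 K), thetaInt hθ - 72} = span {3 * thetaInt hθ - 2} := by
  have rel := thetaInt_rel_twentyfour hθ
  set t := thetaInt hθ with ht
  exact span_pair_eq_span_singleton (u := 2) (v := 3) (δ := -9 * t ^ 2 + 210 * t - 67)
    (ε := 6 * t ^ 2 - 140 * t + 45)
    (by ring) (by linear_combination (27 : 𝓞 K) * rel) (by linear_combination (-18 : 𝓞 K) * rel)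

/-- **`𝔭₁₁ (109, θ - 25) = (2θ² - 2θ - 1)`** (`N = 1199`). [folklore] -/
theorem P11_mul_P109a_twentyfour (hθ : aeval θ (csPoly 24) = 0) :
    span {(11 : 𝓞 K), thetaInt hθ - 3} * span {(109 : 𝓞 K), thetaInt hθ - 25} =
      span {2 * thetaInt hθ ^ 2 - 2 * thetaInt hθ - 1} := by
  have rel := thetaInt_rel_twentyfour hθ
  set t := thetaInt hθ with ht
  exact span_pair_mul_span_pair_eq_span_singleton
    (δ₁ := 2 * t ^ 2 + 2 * t - 1103) (δ₂ := -11 * t + 253)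
    (δ₃ := 4 * t ^ 2 - 105 * t + 301) (δ₄ := -t ^ 2 + 26 * t - 69)
    (u₁ := -1) (u₂ := -5) (u₃ := 1) (u₄ := 2)
    (by linear_combination (-4 * t - 96) * rel) (by linear_combination (22 : 𝓞 K) * rel)
    (by linear_combination (-8 * t + 26) * rel) (by linear_combination (2 * t - 6) * rel)
    (by ring)

/-- **`𝔭₁₁ (109, θ - 35) = (16θ - 15)`** (`N = -1199`). [folklore] -/
theorem P11_mul_P109b_twentyfour (hθ : aeval θ (csPoly 24) = 0) :
    span {(11 : 𝓞 K), thetaInt hθ - 3} * span {(109 : 𝓞 K), thetaInt hθ - 35} =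
      span {16 * thetaInt hθ - 15} := by
  have rel := thetaInt_rel_twentyfour hθ
  set t := thetaInt hθ with ht
  exact span_pair_mul_span_pair_eq_span_singleton
    (δ₁ := -256 * t ^ 2 + 5904 * t - 353) (δ₂ := 80 * t ^ 2 - 1845 * t + 111)
    (δ₃ := 48 * t ^ 2 - 1107 * t + 73) (δ₄ := -15 * t ^ 2 + 346 * t - 23)
    (u₁ := 15) (u₂ := 51) (u₃ := -5) (u₄ := 0)
    (by linear_combination (4096 : 𝓞 K) * rel) (by linear_combination (-1280 : 𝓞 K) * rel)
    (by linear_combination (-768 : 𝓞 K) * rel) (by linear_combination (240 : 𝓞 K) * rel)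
    (by ring)

/-- **`(109, θ - 73) = (3θ - 1)` is principal** (`N(3θ - 1) = -109`). [folklore] -/
theorem P109c_eq_twentyfour (hθ : aeval θ (csPoly 24) = 0) :
    span {(109 : 𝓞 K), thetaInt hθ - 73} = span {3 * thetaInt hθ - 1} := by
  have rel := thetaInt_rel_twentyfour hθ
  set t := thetaInt hθ with ht
  exact span_pair_eq_span_singleton (u := 2) (v := 3) (δ := -9 * t ^ 2 + 213 * t - 136)
    (ε := 6 * t ^ 2 - 142 * t + 91)
    (by ring) (by linear_combination (27 : 𝓞 K) * rel) (by linear_combination (-18 : 𝓞 K) * rel)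

/-- **`𝔭₇ 𝔭₁₁₃ = (2θ² - 4θ + 1)`** (`N = -791`). [folklore] -/
theorem P7_mul_P113_twentyfour (hθ : aeval θ (csPoly 24) = 0) :
    span {(7 : 𝓞 K), thetaInt hθ - 6} * span {(113 : 𝓞 K), thetaInt hθ - 32} =
      span {2 * thetaInt hθ ^ 2 - 4 * thetaInt hθ + 1} := by
  have rel := thetaInt_rel_twentyfour hθ
  set t := thetaInt hθ with ht
  exact span_pair_mul_span_pair_eq_span_singleton
    (δ₁ := 86 * t ^ 2 - 2024 * t + 1055) (δ₂ := -24 * t ^ 2 + 565 * t - 298)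
    (δ₃ := -68 * t ^ 2 + 1603 * t - 892) (δ₄ := 19 * t ^ 2 - 448 * t + 252)
    (u₁ := -5) (u₂ := -22) (u₃ := 2) (u₄ := 2)
    (by linear_combination (-172 * t + 264) * rel) (by linear_combination (48 * t - 74) * rel)
    (by linear_combination (136 * t - 214) * rel) (by linear_combination (-38 * t + 60) * rel)
    (by ring)

/-- **`𝔭₂₃ 𝔭₁₂₇ = (θ² - 9θ + 2)`** (`N = -2921`). [folklore] -/
theorem P23_mul_P127_twentyfour (hθ : aeval θ (csPoly 24) = 0) :
    span {(23 : 𝓞 K), thetaInt hθ - 17} * span {(127 : 𝓞 K), thetaInt hθ - 115} =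
      span {thetaInt hθ ^ 2 - 9 * thetaInt hθ + 2} := by
  have rel := thetaInt_rel_twentyfour hθ
  set t := thetaInt hθ with ht
  exact span_pair_mul_span_pair_eq_span_singleton
    (δ₁ := 114 * t ^ 2 - 2707 * t + 1959) (δ₂ := -103 * t ^ 2 + 2446 * t - 1773)
    (δ₃ := -83 * t ^ 2 + 1972 * t - 1443) (δ₄ := 75 * t ^ 2 - 1782 * t + 1306)
    (u₁ := 34) (u₂ := 44) (u₃ := -7) (u₄ := 1)
    (by linear_combination (-114 * t + 997) * rel) (by linear_combination (103 * t - 901) * rel)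
    (by linear_combination (83 * t - 727) * rel) (by linear_combination (-75 * t + 657) * rel)
    (by ring)


/-! ### The class group is generated by `a = [𝔭₇]` and `c = [𝔭₁₁]`, `a² = c² = 1` -/

/-- `(7, θ - 6)` is a nonzero ideal. [folklore] -/
theorem P7_mem_nonZeroDivisors_twentyfour (hθ : aeval θ (csPoly 24) = 0) :
    span {(7 : 𝓞 K), thetaInt hθ - 6} ∈ (Ideal (𝓞 K))⁰ := by
  have h := span_pair_natCast_mem_nonZeroDivisors (K := K) (n := 7) (by norm_num)
    (thetaInt hθ - 6)
  simp only [Nat.cast_ofNat] at h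
  exact h

/-- `(11, θ - 3)` is a nonzero ideal. [folklore] -/
theorem P11_mem_nonZeroDivisors_twentyfour (hθ : aeval θ (csPoly 24) = 0) :
    span {(11 : 𝓞 K), thetaInt hθ - 3} ∈ (Ideal (𝓞 K))⁰ := by
  have h := span_pair_natCast_mem_nonZeroDivisors (K := K) (n := 11) (by norm_num)
    (thetaInt hθ - 3)
  simp only [Nat.cast_ofNat] at h
  exact h

/-- `(23, θ - 17)` is a nonzero ideal. [folklore] -/
theorem P23_mem_nonZeroDivisors_twentyfour (hθ : aeval θ (csPoly 24) = 0) :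
    span {(23 : 𝓞 K), thetaInt hθ - 17} ∈ (Ideal (𝓞 K))⁰ := by
  have h := span_pair_natCast_mem_nonZeroDivisors (K := K) (n := 23) (by norm_num)
    (thetaInt hθ - 17)
  simp only [Nat.cast_ofNat] at h
  exact h

/-- **Every ideal class of the trace `24` field is one of `1`, `[𝔭₇]`, `[𝔭₁₁]`, `[𝔭₂₃] = [𝔭₇][𝔭₁₁]`**
(`𝔭₇ = (7, θ - 6)`, `𝔭₁₁ = (11, θ - 3)`, `𝔭₂₃ = (23, θ - 17)`), with `[𝔭₇]² = 1` (`𝔭₇² = (θ + 1)`),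
`[𝔭₁₁]² = 1` (`𝔭₁₁² = (θ - 3)`) and `𝔭₇ 𝔭₁₁ 𝔭₂₃ = (2θ² - 3θ + 2)`; so the class group is a quotient of
`ℤ/2 × ℤ/2`. Proof: `d_K = 210649`, `⌊M_K⌋ ≤ 129`, Dedekind–Kummer at `p ≤ 129` and the relations listed in
the module docstring. [cite: KimYamada2023, §6.1 (proof of Thm. B)] -/
theorem classGroup_mem_four_twentyfour (hθ : aeval θ (csPoly 24) = 0) (h3 : finrank ℚ K = 3)
    (C : ClassGroup (𝓞 K)) :
    C = 1 ∨ C = ClassGroup.mk0 ⟨span {(7 : 𝓞 K), thetaInt hθ - 6}, P7_mem_nonZeroDivisors_twentyfour hθ⟩ ∨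
      C = ClassGroup.mk0 ⟨span {(11 : 𝓞 K), thetaInt hθ - 3}, P11_mem_nonZeroDivisors_twentyfour hθ⟩ ∨
      C = ClassGroup.mk0 ⟨span {(23 : 𝓞 K), thetaInt hθ - 17}, P23_mem_nonZeroDivisors_twentyfour hθ⟩ := by
  classical
  have rel := thetaInt_rel_twentyfour hθ
  set t := thetaInt hθ with ht
  have hne : ∀ (x y : 𝓞 K) (n : ℕ), x * y = n → n ≠ 0 → x ≠ 0 := by
    rintro x y n hxy hn rfl
    rw [zero_mul] at hxy
    exact hn (by exact_mod_cast hxy.symm)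
  have hne1 : t + 1 ≠ 0 :=
    hne _ (t ^ 2 - 25 * t + 48) 49 (by push_cast; linear_combination (1 : 𝓞 K) * rel)
      (by norm_num)
  have hne2 : t - 3 ≠ 0 :=
    hne _ (t ^ 2 - 21 * t - 40) 121 (by push_cast; linear_combination (1 : 𝓞 K) * rel)
      (by norm_num)
  have hne3 : 2 * t ^ 2 - 3 * t + 2 ≠ 0 :=
    hne _ (-47 * t ^ 2 + 1042 * t + 901) 1771 (by push_cast; linear_combination (-94 * t - 31) * rel)
      (by norm_num)
  have hne4 : 4 * t - 1 ≠ 0 :=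
    hne _ (-16 * t ^ 2 + 380 * t - 273) 209 (by push_cast; linear_combination (-64 : 𝓞 K) * rel)
      (by norm_num)
  have hne5 : 4 * t - 3 ≠ 0 :=
    hne _ (-16 * t ^ 2 + 372 * t - 89) 203 (by push_cast; linear_combination (-64 : 𝓞 K) * rel)
      (by norm_num)
  have hne6 : 3 * t - 5 ≠ 0 :=
    hne _ (9 * t ^ 2 - 201 * t - 128) 667 (by push_cast; linear_combination (27 : 𝓞 K) * rel)
      (by norm_num)
  have hne7 : 5 * t - 4 ≠ 0 :=
    hne _ (-25 * t ^ 2 + 580 * t - 111) 319 (by push_cast; linear_combination (-125 : 𝓞 K) * rel)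
      (by norm_num)
  have hne8 : 3 * t - 4 ≠ 0 :=
    hne _ (9 * t ^ 2 - 204 * t - 65) 287 (by push_cast; linear_combination (27 : 𝓞 K) * rel)
      (by norm_num)
  have hne9 : t ^ 2 + 2 * t - 1 ≠ 0 :=
    hne _ (-76 * t ^ 2 + 1797 * t - 1122) 943 (by push_cast; linear_combination (-76 * t - 179) * rel)
      (by norm_num)
  have hne10 : t ^ 2 + t - 1 ≠ 0 :=
    hne _ (-49 * t ^ 2 + 1150 * t - 526) 451 (by push_cast; linear_combination (-49 * t - 75) * rel)
      (by norm_num)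
  have hne11 : 3 * t - 7 ≠ 0 :=
    hne _ (9 * t ^ 2 - 195 * t - 248) 1763 (by push_cast; linear_combination (27 : 𝓞 K) * rel)
      (by norm_num)
  have hne12 : t ^ 2 - 5 * t + 3 ≠ 0 :=
    hne _ (75 * t ^ 2 - 1744 * t + 436) 989 (by push_cast; linear_combination (75 * t - 319) * rel)
      (by norm_num)
  have hne13 : t + 6 ≠ 0 :=
    hne _ (t ^ 2 - 30 * t + 203) 1219 (by push_cast; linear_combination (1 : 𝓞 K) * rel)
      (by norm_num)
  have hne14 : 3 * t + 2 ≠ 0 :=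
    hne _ (9 * t ^ 2 - 222 * t + 355) 737 (by push_cast; linear_combination (27 : 𝓞 K) * rel)
      (by norm_num)
  have hne15 : 6 * t - 1 ≠ 0 :=
    hne _ (-36 * t ^ 2 + 858 * t - 685) 469 (by push_cast; linear_combination (-216 : 𝓞 K) * rel)
      (by norm_num)
  have hne16 : 7 * t - 4 ≠ 0 :=
    hne _ (-49 * t ^ 2 + 1148 * t - 471) 1541 (by push_cast; linear_combination (-343 : 𝓞 K) * rel)
      (by norm_num)
  have hne17 : t - 17 ≠ 0 :=
    hne _ (t ^ 2 - 7 * t - 96) 1633 (by push_cast; linear_combination (1 : 𝓞 K) * rel)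
      (by norm_num)
  have hne18 : t - 6 ≠ 0 :=
    hne _ (t ^ 2 - 18 * t - 85) 511 (by push_cast; linear_combination (1 : 𝓞 K) * rel)
      (by norm_num)
  have hne19 : 5 * t - 2 ≠ 0 :=
    hne _ (-25 * t ^ 2 + 590 * t - 339) 553 (by push_cast; linear_combination (-125 : 𝓞 K) * rel)
      (by norm_num)
  have hne20 : 2 * t - 5 ≠ 0 :=
    hne _ (4 * t ^ 2 - 86 * t - 123) 623 (by push_cast; linear_combination (8 : 𝓞 K) * rel)
      (by norm_num)
  have hne21 : t ^ 2 - 4 * t + 2 ≠ 0 :=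
    hne _ (59 * t ^ 2 - 1377 * t + 459) 721 (by push_cast; linear_combination (59 * t - 197) * rel)
      (by norm_num)
  have hne22 : t ^ 2 + 15 * t - 15 ≠ 0 :=
    hne _ (-623 * t ^ 2 + 14366 * t - 820) 2369 (by push_cast; linear_combination (-623 * t - 9931) * rel)
      (by norm_num)
  have hne23 : 6 * t - 7 ≠ 0 :=
    hne _ (36 * t ^ 2 - 822 * t - 131) 1133 (by push_cast; linear_combination (216 : 𝓞 K) * rel)
      (by norm_num)
  have hne24 : 2 * t ^ 2 - 2 * t - 1 ≠ 0 :=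
    hne _ (2 * t ^ 2 + 2 * t - 1103) 1199 (by push_cast; linear_combination (4 * t + 96) * rel)
      (by norm_num)
  have hne25 : 16 * t - 15 ≠ 0 :=
    hne _ (-256 * t ^ 2 + 5904 * t - 353) 1199 (by push_cast; linear_combination (-4096 : 𝓞 K) * rel)
      (by norm_num)
  have hne26 : 2 * t ^ 2 - 4 * t + 1 ≠ 0 :=
    hne _ (86 * t ^ 2 - 2024 * t + 1055) 791 (by push_cast; linear_combination (172 * t - 264) * rel)
      (by norm_num)
  have hne27 : t ^ 2 - 9 * t + 2 ≠ 0 :=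
    hne _ (114 * t ^ 2 - 2707 * t + 1959) 2921 (by push_cast; linear_combination (114 * t - 997) * rel)
      (by norm_num)
  have hinv : ∀ (P Q : Ideal (𝓞 K)) (hP0 : P ∈ (Ideal (𝓞 K))⁰) (hQ0 : Q ∈ (Ideal (𝓞 K))⁰) (x : 𝓞 K),
      x ≠ 0 → P * Q = span {x} → ClassGroup.mk0 ⟨P, hP0⟩ = (ClassGroup.mk0 ⟨Q, hQ0⟩)⁻¹ := by
    intro P Q hP0 hQ0 x hx hPQ
    exact ClassGroup.mk0_eq_mk0_inv_iff.mpr ⟨x, hx, by simpa using hPQ⟩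
  have hmulcls : ∀ (P Q R : Ideal (𝓞 K)) (hP0 : P ∈ (Ideal (𝓞 K))⁰) (hQ0 : Q ∈ (Ideal (𝓞 K))⁰)
      (hR0 : R ∈ (Ideal (𝓞 K))⁰), P * Q = R →
        ClassGroup.mk0 ⟨P, hP0⟩ * ClassGroup.mk0 ⟨Q, hQ0⟩ = ClassGroup.mk0 ⟨R, hR0⟩ := by
    intro P Q R hP0 hQ0 hR0 hPQ
    rw [← map_mul]
    congr 1
    exact Subtype.ext (by simpa using hPQ)
  have hnz : ∀ (n : ℕ) (hn : n ≠ 0) (x : 𝓞 K), span {(n : 𝓞 K), x} ∈ (Ideal (𝓞 K))⁰ :=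
    fun n hn x => span_pair_natCast_mem_nonZeroDivisors (K := K) hn x
  have hP7 : span {(7 : 𝓞 K), t - 6} ∈ (Ideal (𝓞 K))⁰ := P7_mem_nonZeroDivisors_twentyfour hθ
  have hP11 : span {(11 : 𝓞 K), t - 3} ∈ (Ideal (𝓞 K))⁰ := P11_mem_nonZeroDivisors_twentyfour hθ
  have hP23 : span {(23 : 𝓞 K), t - 17} ∈ (Ideal (𝓞 K))⁰ := P23_mem_nonZeroDivisors_twentyfour hθ
  have hI77 : span {(77 : 𝓞 K), t - 69} ∈ (Ideal (𝓞 K))⁰ := by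
    have h := hnz 77 (by norm_num) (t - 69)
    simp only [Nat.cast_ofNat] at h
    exact h
  have hP41b : span {(41 : 𝓞 K), t - 16} ∈ (Ideal (𝓞 K))⁰ := by
    have h := hnz 41 (by norm_num) (t - 16)
    simp only [Nat.cast_ofNat] at h
    exact h
  set a : ClassGroup (𝓞 K) := ClassGroup.mk0 ⟨span {(7 : 𝓞 K), t - 6}, hP7⟩ with ha
  set c : ClassGroup (𝓞 K) := ClassGroup.mk0 ⟨span {(11 : 𝓞 K), t - 3}, hP11⟩ with hc
  have ha2 : a * a = 1 := by
    have h : a = a⁻¹ := ClassGroup.mk0_eq_mk0_inv_iff.mpr ⟨_, hne1, by simpa using P7_mul_P7_twentyfour hθ⟩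
    rwa [eq_inv_iff_mul_eq_one] at h
  have hc2 : c * c = 1 := by
    have h : c = c⁻¹ := ClassGroup.mk0_eq_mk0_inv_iff.mpr ⟨_, hne2, by simpa using P11_mul_P11_twentyfour hθ⟩
    rwa [eq_inv_iff_mul_eq_one] at h
  have h77cls : ClassGroup.mk0 ⟨span {(77 : 𝓞 K), t - 69}, hI77⟩ = a * c := by
    rw [ha, hc, hmulcls _ _ _ hP7 hP11 hI77 (P7_mul_P11_twentyfour hθ)]
  have h23cls : ClassGroup.mk0 ⟨span {(23 : 𝓞 K), t - 17}, hP23⟩ = (a * c)⁻¹ := by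
    rw [← h77cls]
    exact hinv _ _ hP23 hI77 _ hne3 (by rw [mul_comm]; exact I77_mul_P23_twentyfour hθ)
  have hacinv : (a * c)⁻¹ = a * c := by
    rw [eq_comm, eq_inv_iff_mul_eq_one, mul_mul_mul_comm, ha2, hc2, mul_one]
  have h41bcls : ClassGroup.mk0 ⟨span {(41 : 𝓞 K), t - 16}, hP41b⟩ = a * c := by
    rw [hinv _ _ hP41b hP23 _ hne9 (by rw [mul_comm]; exact P23_mul_P41b_twentyfour hθ), h23cls, inv_inv]
  let H : Subgroup (ClassGroup (𝓞 K)) := Subgroup.zpowers a ⊔ Subgroup.zpowers c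
  have hprinc : ∀ (P : Ideal (𝓞 K)) (hP0 : P ∈ (Ideal (𝓞 K))⁰) (x : 𝓞 K), P = span {x} →
      ClassGroup.mk0 ⟨P, hP0⟩ ∈ H := by
    intro P hP0 x hPx
    have : ClassGroup.mk0 ⟨P, hP0⟩ = 1 :=
      (ClassGroup.mk0_eq_one_iff hP0).mpr ⟨⟨x, by rw [hPx, submodule_span_eq]⟩⟩
    rw [this]
    exact H.one_mem
  -- Minkowski: `⌊M_K⌋ ≤ 129`
  have hd : ((|NumberField.discr K| : ℤ) : ℝ) ≤ (210649 : ℕ) := by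
    rw [discr_eq_twentyfour hθ h3]
    norm_num
  have hfloor := floor_minkowskiBound_le_cubic h3 hd (s := 459) (U := 129) (by norm_num)
    (by norm_num) (by norm_num)
  have htop : H = ⊤ := by
    refine classGroup_subgroup_eq_top_of_primesOver H hfloor fun p hp hprime P hP0 hP hle => ?_
    have hpU : p ≤ 129 := (Finset.mem_Icc.mp hp).2
    have h1p : 1 ≤ p := (Finset.mem_Icc.mp hp).1
    interval_cases p
    · exact absurd hprime (by decide)
    · exact hprinc P hP0 _ (eq_span_of_inert_twentyfour hθ h3 (by norm_num) hP)
    · exact hprinc P hP0 _ (eq_span_of_inert_twentyfour hθ h3 (by norm_num) hP)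
    · exact absurd hprime (by decide)
    · exact hprinc P hP0 _ (eq_span_of_inert_twentyfour hθ h3 (by norm_num) hP)
    · exact absurd hprime (by decide)
    · -- `p = 7`
      rcases eq_P7_or_eq_Q7_twentyfour hθ h3 hP with h | h <;> subst h
      · exact Subgroup.mem_sup_left (Subgroup.mem_zpowers a)
      · rw [hinv _ _ hP0 hP7 7 (by norm_num) (by rw [mul_comm]; exact P7_mul_Q7_twentyfour hθ)]
        exact H.inv_mem (Subgroup.mem_sup_left (Subgroup.mem_zpowers a))
    · exact absurd hprime (by decide)
    · exact absurd hprime (by decide)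
    · exact absurd hprime (by decide)
    · -- `p = 11`
      rcases eq_P11_or_eq_Q11_twentyfour hθ h3 hP with h | h <;> subst h
      · exact Subgroup.mem_sup_right (Subgroup.mem_zpowers c)
      · rw [hinv _ _ hP0 hP11 11 (by norm_num) (by rw [mul_comm]; exact P11_mul_Q11_twentyfour hθ)]
        exact H.inv_mem (Subgroup.mem_sup_right (Subgroup.mem_zpowers c))
    · exact absurd hprime (by decide)
    · exact hprinc P hP0 _ (eq_span_of_inert_twentyfour hθ h3 (by norm_num) hP)
    · exact absurd hprime (by decide)
    · exact absurd hprime (by decide)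
    · exact absurd hprime (by decide)
    · exact hprinc P hP0 _ (eq_span_of_inert_twentyfour hθ h3 (by norm_num) hP)
    · exact absurd hprime (by decide)
    · -- `p = 19`
      have h := eq_span_pair_of_unique_root_twentyfour hθ h3 (Or.inl ⟨rfl, rfl⟩) hP hle
      simp only [Nat.cast_ofNat, Int.cast_ofNat] at h
      subst h
      rw [hinv _ _ hP0 hP11 _ hne4 (by rw [mul_comm]; exact P11_mul_P19_twentyfour hθ)]
      exact H.inv_mem (Subgroup.mem_sup_right (Subgroup.mem_zpowers c))
    · exact absurd hprime (by decide)
    · exact absurd hprime (by decide)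
    · exact absurd hprime (by decide)
    · -- `p = 23`
      have h := eq_span_pair_of_unique_root_twentyfour hθ h3 (Or.inr (Or.inl ⟨rfl, rfl⟩)) hP hle
      simp only [Nat.cast_ofNat, Int.cast_ofNat] at h
      subst h
      rw [show ClassGroup.mk0 ⟨_, hP0⟩ = ClassGroup.mk0 ⟨_, hP23⟩ from rfl, h23cls]
      exact H.inv_mem (H.mul_mem (Subgroup.mem_sup_left (Subgroup.mem_zpowers a)) (Subgroup.mem_sup_right (Subgroup.mem_zpowers c)))
    · exact absurd hprime (by decide)
    · exact absurd hprime (by decide)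
    · exact absurd hprime (by decide)
    · exact absurd hprime (by decide)
    · exact absurd hprime (by decide)
    · -- `p = 29` (splits)
      rcases eq_P29_twentyfour hθ h3 hP with h | h | h <;> subst h
      · rw [hinv _ _ hP0 hP7 _ hne5 (by rw [mul_comm]; exact P7_mul_P29a_twentyfour hθ)]
        exact H.inv_mem (Subgroup.mem_sup_left (Subgroup.mem_zpowers a))
      · rw [hinv _ _ hP0 hP23 _ hne6 (by rw [mul_comm]; exact P23_mul_P29b_twentyfour hθ), h23cls, inv_inv]
        exact H.mul_mem (Subgroup.mem_sup_left (Subgroup.mem_zpowers a)) (Subgroup.mem_sup_right (Subgroup.mem_zpowers c))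
      · rw [hinv _ _ hP0 hP11 _ hne7 (by rw [mul_comm]; exact P11_mul_P29c_twentyfour hθ)]
        exact H.inv_mem (Subgroup.mem_sup_right (Subgroup.mem_zpowers c))
    · exact absurd hprime (by decide)
    · exact hprinc P hP0 _ (eq_span_of_inert_twentyfour hθ h3 (by norm_num) hP)
    · exact absurd hprime (by decide)
    · exact absurd hprime (by decide)
    · exact absurd hprime (by decide)
    · exact absurd hprime (by decide)
    · exact absurd hprime (by decide)
    · -- `p = 37`
      have h := eq_span_pair_of_unique_root_twentyfour hθ h3 (Or.inr (Or.inr (Or.inl ⟨rfl, rfl⟩))) hP hle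
      simp only [Nat.cast_ofNat, Int.cast_ofNat] at h
      subst h
      exact hprinc _ hP0 _ (P37_eq_twentyfour hθ)
    · exact absurd hprime (by decide)
    · exact absurd hprime (by decide)
    · exact absurd hprime (by decide)
    · -- `p = 41` (splits)
      rcases eq_P41_twentyfour hθ h3 hP with h | h | h <;> subst h
      · rw [hinv _ _ hP0 hP7 _ hne8 (by rw [mul_comm]; exact P7_mul_P41a_twentyfour hθ)]
        exact H.inv_mem (Subgroup.mem_sup_left (Subgroup.mem_zpowers a))
      · rw [show ClassGroup.mk0 ⟨_, hP0⟩ = ClassGroup.mk0 ⟨_, hP41b⟩ from rfl, h41bcls]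
        exact H.mul_mem (Subgroup.mem_sup_left (Subgroup.mem_zpowers a)) (Subgroup.mem_sup_right (Subgroup.mem_zpowers c))
      · rw [hinv _ _ hP0 hP11 _ hne10 (by rw [mul_comm]; exact P11_mul_P41c_twentyfour hθ)]
        exact H.inv_mem (Subgroup.mem_sup_right (Subgroup.mem_zpowers c))
    · exact absurd hprime (by decide)
    · -- `p = 43` (splits)
      rcases eq_P43_twentyfour hθ h3 hP with h | h | h <;> subst h
      · exact hprinc _ hP0 _ (P43a_eq_twentyfour hθ)
      · rw [hinv _ _ hP0 hP41b _ hne11 (by rw [mul_comm]; exact P41b_mul_P43b_twentyfour hθ), h41bcls]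
        exact H.inv_mem (H.mul_mem (Subgroup.mem_sup_left (Subgroup.mem_zpowers a)) (Subgroup.mem_sup_right (Subgroup.mem_zpowers c)))
      · rw [hinv _ _ hP0 hP23 _ hne12 (by rw [mul_comm]; exact P23_mul_P43c_twentyfour hθ), h23cls, inv_inv]
        exact H.mul_mem (Subgroup.mem_sup_left (Subgroup.mem_zpowers a)) (Subgroup.mem_sup_right (Subgroup.mem_zpowers c))
    · exact absurd hprime (by decide)
    · exact absurd hprime (by decide)
    · exact absurd hprime (by decide)
    · exact hprinc P hP0 _ (eq_span_of_inert_twentyfour hθ h3 (by norm_num) hP)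
    · exact absurd hprime (by decide)
    · exact absurd hprime (by decide)
    · exact absurd hprime (by decide)
    · exact absurd hprime (by decide)
    · exact absurd hprime (by decide)
    · -- `p = 53`
      have h := eq_span_pair_of_unique_root_twentyfour hθ h3 (Or.inr (Or.inr (Or.inr (Or.inl ⟨rfl, rfl⟩)))) hP hle
      simp only [Nat.cast_ofNat, Int.cast_ofNat] at h
      subst h
      rw [hinv _ _ hP0 hP23 _ hne13 (by rw [mul_comm]; exact P23_mul_P53_twentyfour hθ), h23cls, inv_inv]
      exact H.mul_mem (Subgroup.mem_sup_left (Subgroup.mem_zpowers a)) (Subgroup.mem_sup_right (Subgroup.mem_zpowers c))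
    · exact absurd hprime (by decide)
    · exact absurd hprime (by decide)
    · exact absurd hprime (by decide)
    · exact absurd hprime (by decide)
    · exact absurd hprime (by decide)
    · exact hprinc P hP0 _ (eq_span_of_inert_twentyfour hθ h3 (by norm_num) hP)
    · exact absurd hprime (by decide)
    · exact hprinc P hP0 _ (eq_span_of_inert_twentyfour hθ h3 (by norm_num) hP)
    · exact absurd hprime (by decide)
    · exact absurd hprime (by decide)
    · exact absurd hprime (by decide)
    · exact absurd hprime (by decide)
    · exact absurd hprime (by decide)
    · -- `p = 67` (splits)
      rcases eq_P67_twentyfour hθ h3 hP with h | h | h <;> subst h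
      · rw [hinv _ _ hP0 hP11 _ hne14 (by rw [mul_comm]; exact P11_mul_P67a_twentyfour hθ)]
        exact H.inv_mem (Subgroup.mem_sup_right (Subgroup.mem_zpowers c))
      · rw [hinv _ _ hP0 hP7 _ hne15 (by rw [mul_comm]; exact P7_mul_P67b_twentyfour hθ)]
        exact H.inv_mem (Subgroup.mem_sup_left (Subgroup.mem_zpowers a))
      · rw [hinv _ _ hP0 hP23 _ hne16 (by rw [mul_comm]; exact P23_mul_P67c_twentyfour hθ), h23cls, inv_inv]
        exact H.mul_mem (Subgroup.mem_sup_left (Subgroup.mem_zpowers a)) (Subgroup.mem_sup_right (Subgroup.mem_zpowers c))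
    · exact absurd hprime (by decide)
    · exact absurd hprime (by decide)
    · exact absurd hprime (by decide)
    · -- `p = 71`
      have h := eq_span_pair_of_unique_root_twentyfour hθ h3 (Or.inr (Or.inr (Or.inr (Or.inr (Or.inl ⟨rfl, rfl⟩))))) hP hle
      simp only [Nat.cast_ofNat, Int.cast_ofNat] at h
      subst h
      rw [hinv _ _ hP0 hP23 _ hne17 (by rw [mul_comm]; exact P23_mul_P71_twentyfour hθ), h23cls, inv_inv]
      exact H.mul_mem (Subgroup.mem_sup_left (Subgroup.mem_zpowers a)) (Subgroup.mem_sup_right (Subgroup.mem_zpowers c))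
    · exact absurd hprime (by decide)
    · -- `p = 73`
      have h := eq_span_pair_of_unique_root_twentyfour hθ h3 (Or.inr (Or.inr (Or.inr (Or.inr (Or.inr (Or.inl ⟨rfl, rfl⟩)))))) hP hle
      simp only [Nat.cast_ofNat, Int.cast_ofNat] at h
      subst h
      rw [hinv _ _ hP0 hP7 _ hne18 (by rw [mul_comm]; exact P7_mul_P73_twentyfour hθ)]
      exact H.inv_mem (Subgroup.mem_sup_left (Subgroup.mem_zpowers a))
    · exact absurd hprime (by decide)
    · exact absurd hprime (by decide)
    · exact absurd hprime (by decide)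
    · exact absurd hprime (by decide)
    · exact absurd hprime (by decide)
    · -- `p = 79`
      have h := eq_span_pair_of_unique_root_twentyfour hθ h3 (Or.inr (Or.inr (Or.inr (Or.inr (Or.inr (Or.inr (Or.inl ⟨rfl, rfl⟩))))))) hP hle
      simp only [Nat.cast_ofNat, Int.cast_ofNat] at h
      subst h
      rw [hinv _ _ hP0 hP7 _ hne19 (by rw [mul_comm]; exact P7_mul_P79_twentyfour hθ)]
      exact H.inv_mem (Subgroup.mem_sup_left (Subgroup.mem_zpowers a))
    · exact absurd hprime (by decide)
    · exact absurd hprime (by decide)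
    · exact absurd hprime (by decide)
    · exact hprinc P hP0 _ (eq_span_of_inert_twentyfour hθ h3 (by norm_num) hP)
    · exact absurd hprime (by decide)
    · exact absurd hprime (by decide)
    · exact absurd hprime (by decide)
    · exact absurd hprime (by decide)
    · exact absurd hprime (by decide)
    · -- `p = 89`
      have h := eq_span_pair_of_unique_root_twentyfour hθ h3 (Or.inr (Or.inr (Or.inr (Or.inr (Or.inr (Or.inr (Or.inr (Or.inl ⟨rfl, rfl⟩)))))))) hP hle
      simp only [Nat.cast_ofNat, Int.cast_ofNat] at h
      subst h
      rw [hinv _ _ hP0 hP7 _ hne20 (by rw [mul_comm]; exact P7_mul_P89_twentyfour hθ)]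
      exact H.inv_mem (Subgroup.mem_sup_left (Subgroup.mem_zpowers a))
    · exact absurd hprime (by decide)
    · exact absurd hprime (by decide)
    · exact absurd hprime (by decide)
    · exact absurd hprime (by decide)
    · exact absurd hprime (by decide)
    · exact absurd hprime (by decide)
    · exact absurd hprime (by decide)
    · exact hprinc P hP0 _ (eq_span_of_inert_twentyfour hθ h3 (by norm_num) hP)
    · exact absurd hprime (by decide)
    · exact absurd hprime (by decide)
    · exact absurd hprime (by decide)
    · exact hprinc P hP0 _ (eq_span_of_inert_twentyfour hθ h3 (by norm_num) hP)
    · exact absurd hprime (by decide)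
    · -- `p = 103` (splits)
      rcases eq_P103_twentyfour hθ h3 hP with h | h | h <;> subst h
      · rw [hinv _ _ hP0 hP7 _ hne21 (by rw [mul_comm]; exact P7_mul_P103a_twentyfour hθ)]
        exact H.inv_mem (Subgroup.mem_sup_left (Subgroup.mem_zpowers a))
      · rw [hinv _ _ hP0 hP23 _ hne22 (by rw [mul_comm]; exact P23_mul_P103b_twentyfour hθ), h23cls, inv_inv]
        exact H.mul_mem (Subgroup.mem_sup_left (Subgroup.mem_zpowers a)) (Subgroup.mem_sup_right (Subgroup.mem_zpowers c))
      · rw [hinv _ _ hP0 hP11 _ hne23 (by rw [mul_comm]; exact P11_mul_P103c_twentyfour hθ)]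
        exact H.inv_mem (Subgroup.mem_sup_right (Subgroup.mem_zpowers c))
    · exact absurd hprime (by decide)
    · exact absurd hprime (by decide)
    · exact absurd hprime (by decide)
    · -- `p = 107`
      have h := eq_span_pair_of_unique_root_twentyfour hθ h3 (Or.inr (Or.inr (Or.inr (Or.inr (Or.inr (Or.inr (Or.inr (Or.inr (Or.inl ⟨rfl, rfl⟩))))))))) hP hle
      simp only [Nat.cast_ofNat, Int.cast_ofNat] at h
      subst h
      exact hprinc _ hP0 _ (P107_eq_twentyfour hθ)
    · exact absurd hprime (by decide)
    · -- `p = 109` (splits)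
      rcases eq_P109_twentyfour hθ h3 hP with h | h | h <;> subst h
      · rw [hinv _ _ hP0 hP11 _ hne24 (by rw [mul_comm]; exact P11_mul_P109a_twentyfour hθ)]
        exact H.inv_mem (Subgroup.mem_sup_right (Subgroup.mem_zpowers c))
      · rw [hinv _ _ hP0 hP11 _ hne25 (by rw [mul_comm]; exact P11_mul_P109b_twentyfour hθ)]
        exact H.inv_mem (Subgroup.mem_sup_right (Subgroup.mem_zpowers c))
      · exact hprinc _ hP0 _ (P109c_eq_twentyfour hθ)
    · exact absurd hprime (by decide)
    · exact absurd hprime (by decide)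
    · exact absurd hprime (by decide)
    · -- `p = 113`
      have h := eq_span_pair_of_unique_root_twentyfour hθ h3 (Or.inr (Or.inr (Or.inr (Or.inr (Or.inr (Or.inr (Or.inr (Or.inr (Or.inr (Or.inl ⟨rfl, rfl⟩)))))))))) hP hle
      simp only [Nat.cast_ofNat, Int.cast_ofNat] at h
      subst h
      rw [hinv _ _ hP0 hP7 _ hne26 (by rw [mul_comm]; exact P7_mul_P113_twentyfour hθ)]
      exact H.inv_mem (Subgroup.mem_sup_left (Subgroup.mem_zpowers a))
    · exact absurd hprime (by decide)
    · exact absurd hprime (by decide)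
    · exact absurd hprime (by decide)
    · exact absurd hprime (by decide)
    · exact absurd hprime (by decide)
    · exact absurd hprime (by decide)
    · exact absurd hprime (by decide)
    · exact absurd hprime (by decide)
    · exact absurd hprime (by decide)
    · exact absurd hprime (by decide)
    · exact absurd hprime (by decide)
    · exact absurd hprime (by decide)
    · exact absurd hprime (by decide)
    · -- `p = 127`
      have h := eq_span_pair_of_unique_root_twentyfour hθ h3 (Or.inr (Or.inr (Or.inr (Or.inr (Or.inr (Or.inr (Or.inr (Or.inr (Or.inr (Or.inr (⟨rfl, rfl⟩))))))))))) hP hle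
      simp only [Nat.cast_ofNat, Int.cast_ofNat] at h
      subst h
      rw [hinv _ _ hP0 hP23 _ hne27 (by rw [mul_comm]; exact P23_mul_P127_twentyfour hθ), h23cls, inv_inv]
      exact H.mul_mem (Subgroup.mem_sup_left (Subgroup.mem_zpowers a)) (Subgroup.mem_sup_right (Subgroup.mem_zpowers c))
    · exact absurd hprime (by decide)
    · exact absurd hprime (by decide)
  have hC : C ∈ H := by rw [htop]; exact Subgroup.mem_top C
  obtain ⟨y, hy, z, hz, rfl⟩ := Subgroup.mem_sup.mp hC
  obtain ⟨i, rfl⟩ := Subgroup.mem_zpowers_iff.mp hy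
  obtain ⟨j, rfl⟩ := Subgroup.mem_zpowers_iff.mp hz
  have ha2' : a ^ (2 : ℤ) = 1 := by rw [zpow_two]; exact ha2
  have hc2' : c ^ (2 : ℤ) = 1 := by rw [zpow_two]; exact hc2
  have hai : a ^ i = 1 ∨ a ^ i = a := by
    obtain ⟨k, rfl | rfl⟩ := Int.even_or_odd' i
    · left; rw [zpow_mul, ha2', one_zpow]
    · right; rw [zpow_add, zpow_mul, ha2', one_zpow, one_mul, zpow_one]
  have hcj : c ^ j = 1 ∨ c ^ j = c := by
    obtain ⟨k, rfl | rfl⟩ := Int.even_or_odd' j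
    · left; rw [zpow_mul, hc2', one_zpow]
    · right; rw [zpow_add, zpow_mul, hc2', one_zpow, one_mul, zpow_one]
  rcases hai with hai | hai <;> rcases hcj with hcj | hcj <;> rw [hai, hcj]
  · left; rw [one_mul]
  · right; right; left; rw [one_mul]
  · right; left; rw [mul_one]
  · right; right; right; rw [← hacinv, ← h23cls]


end Field


/-! ### The ideal classes of `ℤ[X]/(f₂₄)` and Gompf's conjecture for the traces `24` and `-19` -/

section Matrices

/-- **The ideal classes of `ℤ[Θ₂₄] = ℤ[X]/(f₂₄)`**: every non-zero ideal is in the class of one of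
`⟨Θ - 1, 1⟩`, `⟨Θ - 6, 7⟩`, `⟨Θ - 3, 11⟩`, `⟨Θ - 17, 23⟩` (these representatives cover `C(ℤ[Θ₂₄])`). [cite: KimYamada2023, §6.1 (proof of Thm. B)] -/
theorem ideal_class_adjoinRoot_twentyfour (J : Ideal (AdjoinRoot (csPoly 24))) (hJ : J ≠ ⊥) :
    ∃ x y : AdjoinRoot (csPoly 24), x ≠ 0 ∧ y ≠ 0 ∧
      (span {x} * J = span {y} * csIdeal 1 1 24 ∨ span {x} * J = span {y} * csIdeal 6 7 24 ∨ span {x} * J = span {y} * csIdeal 3 11 24 ∨ span {x} * J = span {y} * csIdeal 17 23 24) := by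
  classical
  set θ' := AdjoinRoot.root (csPolyQ 24) with hθ'
  have hθ : aeval θ' (csPoly 24) = 0 := aeval_root_csPoly 24
  have h3 : finrank ℚ (CSField 24) = 3 := finrank_CSField 24
  obtain ⟨e, he⟩ := exists_ringEquiv_adjoinRoot_of_sq hθ h3 csDisc_twentyfour_sq
  set I : Ideal (𝓞 (CSField 24)) := J.map e with hI
  have hIJ : I.map (e.symm : 𝓞 (CSField 24) →+* AdjoinRoot (csPoly 24)) = J := by
    rw [hI]
    exact Ideal.map_of_equiv e (I := J)
  have hI0 : I ≠ ⊥ := by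
    intro h0
    apply hJ
    rw [← hIJ, h0, Ideal.map_bot]
  have hImem : I ∈ (Ideal (𝓞 (CSField 24)))⁰ := mem_nonZeroDivisors_iff_ne_zero.mpr hI0
  have hsymm : ∀ x, (e.symm : 𝓞 (CSField 24) →+* AdjoinRoot (csPoly 24)) (e x) = x :=
    fun x => e.symm_apply_apply x
  have hP7 : (span {(7 : 𝓞 (CSField 24)), thetaInt hθ - 6}).map
      (e.symm : 𝓞 (CSField 24) →+* AdjoinRoot (csPoly 24)) = csIdeal 6 7 24 := by
    rw [Ideal.map_span, Set.image_insert_eq, Set.image_singleton, map_sub, ← he, hsymm, map_ofNat,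
      map_ofNat, csIdeal, Set.pair_comm]
    simp
  have hP11 : (span {(11 : 𝓞 (CSField 24)), thetaInt hθ - 3}).map
      (e.symm : 𝓞 (CSField 24) →+* AdjoinRoot (csPoly 24)) = csIdeal 3 11 24 := by
    rw [Ideal.map_span, Set.image_insert_eq, Set.image_singleton, map_sub, ← he, hsymm, map_ofNat,
      map_ofNat, csIdeal, Set.pair_comm]
    simp
  have hP23 : (span {(23 : 𝓞 (CSField 24)), thetaInt hθ - 17}).map
      (e.symm : 𝓞 (CSField 24) →+* AdjoinRoot (csPoly 24)) = csIdeal 17 23 24 := by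
    rw [Ideal.map_span, Set.image_insert_eq, Set.image_singleton, map_sub, ← he, hsymm, map_ofNat,
      map_ofNat, csIdeal, Set.pair_comm]
    simp
  have hcase : ∀ (P : Ideal (𝓞 (CSField 24))) (hP0 : P ∈ (Ideal (𝓞 (CSField 24)))⁰)
      (Q : Ideal (AdjoinRoot (csPoly 24))),
      P.map (e.symm : 𝓞 (CSField 24) →+* AdjoinRoot (csPoly 24)) = Q →
      ClassGroup.mk0 ⟨I, hImem⟩ = ClassGroup.mk0 ⟨P, hP0⟩ →
        ∃ x y : AdjoinRoot (csPoly 24), x ≠ 0 ∧ y ≠ 0 ∧ span {x} * J = span {y} * Q := by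
    intro P hP0 Q hPQ hcls
    obtain ⟨x, y, hx, hy, hxy⟩ := ClassGroup.mk0_eq_mk0_iff.mp hcls
    refine ⟨(e.symm : 𝓞 (CSField 24) →+* AdjoinRoot (csPoly 24)) x,
      (e.symm : 𝓞 (CSField 24) →+* AdjoinRoot (csPoly 24)) y,
      (map_ne_zero_iff _ e.symm.injective).mpr hx, (map_ne_zero_iff _ e.symm.injective).mpr hy, ?_⟩
    have h := congrArg (Ideal.map (e.symm : 𝓞 (CSField 24) →+* AdjoinRoot (csPoly 24))) hxy
    simp only [Ideal.map_mul, Ideal.map_span, Set.image_singleton] at h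
    rw [hIJ, hPQ] at h
    exact h
  rcases classGroup_mem_four_twentyfour hθ h3 (ClassGroup.mk0 ⟨I, hImem⟩) with h1 | hcl | hcl | hcl
  · obtain ⟨z, hz⟩ := ((ClassGroup.mk0_eq_one_iff hImem).mp h1).principal
    have hz' : I = span {z} := by rw [hz, submodule_span_eq]
    have hz0 : z ≠ 0 := by
      rintro rfl
      apply hI0
      rw [hz', Ideal.span_singleton_eq_bot]
    refine ⟨1, (e.symm : 𝓞 (CSField 24) →+* AdjoinRoot (csPoly 24)) z, one_ne_zero,
      (map_ne_zero_iff _ e.symm.injective).mpr hz0, Or.inl ?_⟩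
    rw [Ideal.span_singleton_one, Ideal.top_mul, csIdeal_one_one, Ideal.mul_top, ← hIJ, hz',
      Ideal.map_span, Set.image_singleton]
  · obtain ⟨x, y, hx, hy, h⟩ := hcase _ _ _ hP7 hcl
    exact ⟨x, y, hx, hy, Or.inr (Or.inl h)⟩
  · obtain ⟨x, y, hx, hy, h⟩ := hcase _ _ _ hP11 hcl
    exact ⟨x, y, hx, hy, Or.inr (Or.inr (Or.inl h))⟩
  · obtain ⟨x, y, hx, hy, h⟩ := hcase _ _ _ hP23 hcl
    exact ⟨x, y, hx, hy, Or.inr (Or.inr (Or.inr (h)))⟩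

/-- `7 ∣ f₂₄(6)`: `(6, 7, 24) ∈ 𝒞𝒮`. [cite: KimYamada2023, §6.1 (proof of Thm. B)] -/
theorem rep0_dvd_eval_csPoly_twentyfour : (7 : ℤ) ∣ (csPoly 24).eval 6 := by
  rw [eval_csPoly]; norm_num

/-- `11 ∣ f₂₄(3)`: `(3, 11, 24) ∈ 𝒞𝒮`. [cite: KimYamada2023, §6.1 (proof of Thm. B)] -/
theorem rep1_dvd_eval_csPoly_twentyfour : (11 : ℤ) ∣ (csPoly 24).eval 3 := by
  rw [eval_csPoly]; norm_num

/-- `23 ∣ f₂₄(17)`: `(17, 23, 24) ∈ 𝒞𝒮`. [cite: KimYamada2023, §6.1 (proof of Thm. B)] -/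
theorem rep2_dvd_eval_csPoly_twentyfour : (23 : ℤ) ∣ (csPoly 24).eval 17 := by
  rw [eval_csPoly]; norm_num

/-- **Every Cappell–Shaneson matrix of trace `24` is similar to one of 4 standard matrices**
(Prop. 2.14). [cite: KimYamada2023, §6.1 (proof of Thm. B) and Prop. 2.14] -/
theorem isConj_standardCSMatrix_of_trace_eq_twentyfour (A : SL(3, ℤ))
    (hdet : ((A : Matrix (Fin 3) (Fin 3) ℤ) - 1).det = 1)
    (htr : Matrix.trace (A : Matrix (Fin 3) (Fin 3) ℤ) = 24) :
    IsConj A (standardCSMatrix 1 1 24 (one_dvd _)) ∨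
      IsConj A (standardCSMatrix 6 7 24 rep0_dvd_eval_csPoly_twentyfour) ∨
      IsConj A (standardCSMatrix 3 11 24 rep1_dvd_eval_csPoly_twentyfour) ∨
      IsConj A (standardCSMatrix 17 23 24 rep2_dvd_eval_csPoly_twentyfour) := by
  have hcover : ∀ J : Ideal (AdjoinRoot (csPoly 24)), J ≠ ⊥ →
      ∃ (c d : ℤ) (_ : d ∣ (csPoly 24).eval c) (x y : AdjoinRoot (csPoly 24)),
        x ≠ 0 ∧ y ≠ 0 ∧ Ideal.span {x} * J = Ideal.span {y} * csIdeal c d 24 ∧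
          ((c = 1 ∧ d = 1) ∨ (c = 6 ∧ d = 7) ∨ (c = 3 ∧ d = 11) ∨ (c = 17 ∧ d = 23)) := by
    intro J hJ
    obtain ⟨x, y, hx, hy, hxy⟩ := ideal_class_adjoinRoot_twentyfour J hJ
    rcases hxy with h0 | h1 | h2 | h3
    · exact ⟨1, 1, one_dvd _, x, y, hx, hy, h0, Or.inl ⟨rfl, rfl⟩⟩
    · exact ⟨6, 7, rep0_dvd_eval_csPoly_twentyfour, x, y, hx, hy, h1, Or.inr (Or.inl ⟨rfl, rfl⟩)⟩
    · exact ⟨3, 11, rep1_dvd_eval_csPoly_twentyfour, x, y, hx, hy, h2, Or.inr (Or.inr (Or.inl ⟨rfl, rfl⟩))⟩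
    · exact ⟨17, 23, rep2_dvd_eval_csPoly_twentyfour, x, y, hx, hy, h3, Or.inr (Or.inr (Or.inr (⟨rfl, rfl⟩)))⟩
  obtain ⟨c, d, h, hconj, hcd⟩ := exists_isConj_standardCSMatrix_of_cover _ hcover A hdet htr
  rcases hcd with ⟨rfl, rfl⟩ | ⟨rfl, rfl⟩ | ⟨rfl, rfl⟩ | ⟨rfl, rfl⟩
  · exact Or.inl hconj
  · exact Or.inr (Or.inl hconj)
  · exact Or.inr (Or.inr (Or.inl hconj))
  · exact Or.inr (Or.inr (Or.inr (hconj)))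

/-- **Kim–Yamada 2023, Theorem B for the trace `24`, PROVED**: the non-trivial classes move by
Gompf moves to the traces `10 = 24 - 2·7`, `2 = 24 - 2·11`, `1 = 24 - 23`, where Gompf's conjecture holds. [cite: KimYamada2023, Thm. B and §6.1] -/
theorem gompfConjectureForTrace_twentyfour : GompfConjectureForTrace 24 := by
  intro A hdet htr
  rcases isConj_standardCSMatrix_of_trace_eq_twentyfour A hdet htr with h0 | h1 | h2 | h3
  · exact (GompfEquiv.of_isConj h0).trans (gompfEquiv_standardCSMatrix_one_one 22 (one_dvd _))
  · exact (GompfEquiv.of_isConj h1).trans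
      (gompfEquiv_standardCSMatrix_akbulutKirbyMatrix_of_modEq
        (gompfConjectureForTrace_ten_of aitchisonRubinstein1984_traceNegFiveClasses_holds) rep0_dvd_eval_csPoly_twentyfour
        (show (24 : ℤ) ≡ 10 [ZMOD 7] by decide))
  · exact (GompfEquiv.of_isConj h2).trans
      (gompfEquiv_standardCSMatrix_akbulutKirbyMatrix_of_modEq
        (gompfConjectureForTrace_of_mem_Icc (by norm_num)) rep1_dvd_eval_csPoly_twentyfour
        (show (24 : ℤ) ≡ 2 [ZMOD 11] by decide))
  · exact (GompfEquiv.of_isConj h3).trans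
      (gompfEquiv_standardCSMatrix_akbulutKirbyMatrix_of_modEq
        (gompfConjectureForTrace_of_mem_Icc (by norm_num)) rep2_dvd_eval_csPoly_twentyfour
        (show (24 : ℤ) ≡ 1 [ZMOD 23] by decide))

/-- **Theorem B for the trace `-19`** (`= 5 - 24`), by Theorem A. [cite: KimYamada2023, Thm. A and Thm. B] -/
theorem gompfConjectureForTrace_neg_nineteen : GompfConjectureForTrace (-19) := by
  have h := gompfConjectureForTrace_of_five_sub gompfConjectureForTrace_twentyfour
  norm_num at h
  exact h

end Matrices


end Literature.Topology.FourManifolds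

end
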